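import Literature.Geometry.Lorentzian.KerrIngoingCoordConnectionII
import Literature.Geometry.Lorentzian.KerrKillingTangency
import Literature.Geometry.Lorentzian.KerrIngoingCoordRicAt
import Literature.Geometry.Lorentzian.CoordDeformationWave
import HarnessLib

/-!
# The zero-energy gauge potential 1-form on subextremal Kerr (Hintz 2026, Lemma 6.10; AHW 2022, Thm 5.1(2))

Reproduction — in the kernel, for **every** mass `M` and spin `a` (no smallness of `|a|/M`) — of the
explicit part of

* P. Hintz, *Nonlinear stability of subextremal Kerr black holes*, arXiv:2606.28253v2 (2026),
  **Lemma 6.10** (`LemmaWGMode0`, TeX l. 6156–6166, printed p. 120): in Boyer–Lindquist coordinates,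
  with `t₀ = t + ∫(r²+a²)/μ dr`, `φ₀ = φ + ∫ a/μ dr`, the kernel of the zero-energy operator
  `\widehat{□_{g_b}}(0)` of the 1-form wave operator is spanned by the divergence-free 1-form
  `ω₍₀₎ := (r/ϱ²)(dt₀ − a sin²θ dφ₀) + ((r_b⁺ − r)/μ_b) dr ∈ r⁻¹ C^∞`, whose proof there is
  "This is the content of [AHW, Theorem 5.1(2)]" =
* L. Andersson, D. Häfner, B. Whiting, *Mode analysis for the linearized Einstein equations on the
  Kerr metric: the large a case*, arXiv:2207.12952, Thm 5.1(2).

Hintz's paper is an UNREFEREED CLAIM under independent audit by this cell (b2b-kerr, HINTZ-PLAN T5(f));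
nothing of its analysis is asserted here. What is PROVED here, as pure coordinate tensor calculus over the
tree's certified Kerr infrastructure (`Kerr.Ingoing.bilin`, the closed-form Christoffel symbols
`Kerr.Ingoing.chrAt_bv_ij`, the rank-generic calculus `MetricCoord.tcov` / `MetricCoord.tlap`):

* `Kerr.Ingoing.omega0 a rm` — the components of `ω₍₀₎` in the tree's ingoing Kerr coordinates
  `u = (t*, r, μ = cos θ, φ)` (`v = t* + r` is Hintz's `t₀`, `φ` is his `φ₀`):
  `ω₍₀₎ = (r/Σ)(dt* + dr − a(1−μ²) dφ) − dr/(r − r₋)`, `Σ = r² + a²μ²`, where `r₋` is the OTHER root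
  of `μ_b = Δ = r² − 2Mr + a²` (`(r₊ − r)/Δ = −1/(r − r₋)`): manifestly smooth across the future event
  horizon `r = r₊` precisely when `r₋ < r₊`, i.e. in the subextremal range;
* `Kerr.Ingoing.tcov_omega0` — the sixteen components `(∇ω₍₀₎)_{ki}` in closed form;
* **`Kerr.Ingoing.div_omega0`** — `g^{jk}(∇ω₍₀₎)_{jk} = 0` (divergence-free = Lorenz gauge);
* **`Kerr.Ingoing.tlap_omega0`** — `(□ω₍₀₎)_i := g^{jk}(∇∇ω₍₀₎)_{jki} = 0`, `i = 0,…,3`: `ω₍₀₎` is a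
  STATIONARY solution of the 1-form (rough / tensor) wave equation, i.e. a zero-energy state, for all
  `M, a, r₋` with `r₋² − 2M r₋ + a² = 0`, at every point with `Σ ≠ 0`, `μ² ≠ 1`, `r ≠ r₋` (this includes
  the future event horizon and a neighbourhood of it inside the black hole);
* **`Kerr.Ingoing.gaugeWaveOp_omega0`** — consequently Hintz's gauge potential wave operator
  `□_{g_b} := 2 δ_g 𝖦_g δ_g^*` (eq. (4.6) `Eq1BoxUps`, printed p. 82, with `E^Υ = 0`), which by the tree's contracted Ricci
  identity `MetricCoord.IsMetricOn.trace_tcov_deform_sub_half` equals `−(□_rough + Ric)` on 1-forms,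
  annihilates `ω₍₀₎` wherever the Kerr components are Ricci-flat in the coordinate sense (hypothesis
  `hRic`; the tree proves `Ric = 0` for these components at the manifold level,
  `Kerr.Ingoing.ricci_eq_zero_of_repr`, and in the coordinate sense, `Kerr.Ingoing.ricAt_bilin_eq_zero`
  of `KerrIngoingCoordRicAt.lean`) — hence UNCONDITIONALLY on `{Σ ≠ 0, μ² ≠ 1, r ≠ r₋}`:
  **`Kerr.Ingoing.gaugeWaveOp_omega0'`**.
* **`Kerr.Ingoing.gradr_deltaStar_omega0_tstar`** (appendix; Lemma 6.11, eq. (6.23) `EqWG0Pair2`, the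
  "explicit computation" of its proof, TeX l. 6193, = Gluing III arXiv:2408.06715 Prop. 3.12): the profile
  `ι_{∂_{t₀}} ι_{∇r} δ_g^* ω₍₀₎ = −(r² + a²)(r² − a²μ²)/(2Σ³)` for ALL `M, a, r₋`, hence `< 0` wherever
  `a² < r²` (`gradr_deltaStar_omega0_tstar_neg`), in particular on `𝓗⁺ = {r = r₊}` for every `|a| < M`
  (`gradr_deltaStar_omega0_tstar_neg_horizon`): the pointwise condition for the b-independent horizon gauge
  1-form `c^Υ_{𝓗⁺}` of Lemma 6.11 holds uniformly in the subextremal range.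

Physical reading (folklore, not used): `(r/Σ)(dv − a sin²θ dφ₀)` is the Kerr–Newman electromagnetic
potential per unit charge, so `dω₍₀₎` is the Coulomb test field on Kerr; the closed term `r₊ dr/Δ` is the
gauge change making the Lorenz-gauge potential smooth at `𝓗⁺`. The sign convention `□_g u = −g^{κλ}u_{;κλ}`
of Hintz (TeX l. 4252) makes `□_g = −tlap`; the statements below are about `tlap` and are sign-free.

Two independent computer-algebra engines (cell files `b2b-kerr-adep1/g5/t5f_engineA.py`, pure Python
exact rationals, and `kit/t5_engineB_sympy.py`, sympy in Boyer–Lindquist coordinates) agree with the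
kernel; they also reproduce Lemma 6.11, eq. (6.21): `⟨[□_{g_b}, t_*]ω₍₀₎, δ(r−r_b⁺)dr⟩_{L²} = 4π` (not formalised here).
Two further engines (cell files `b2b-kerr-adep1/g13/pair2_engineA_sympy.py`, sympy, Boyer–Lindquist
coordinates, Christoffel symbols; `pair2_engineB_dual.py`, exact dual-number arithmetic, ingoing coordinates, Lie
derivative) give the closed form of the (6.23) profile, which the appendix CHECKS in the kernel from `covOmega`.
The closed forms below were generated by engine A and are CHECKED here by Lean (`field_simp`, `ring`);
nothing is taken on trust and no statement of `Prop` type is introduced.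

## References

* P. Hintz, arXiv:2606.28253v2 (2026), Lemma 6.10 and Lemma 6.11 (p. 120), eq. (4.6) (p. 82). [Hintz2026]
* L. Andersson, D. Häfner, B. F. Whiting, arXiv:2207.12952 (J. Eur. Math. Soc., to appear), Thm 5.1(2).
  [AnderssonHafnerWhiting2022]
* B. O'Neill, *Semi-Riemannian geometry*, 1983, Ch. 3, Prop. 3.13, Def. 3.50. [ONeill1983]
-/

noncomputable section

set_option maxSynthPendingDepth 3

open Set Function Module
open scoped ContDiff Topology
open Literature.Geometry.Lorentzian.MetricCoord

namespace Literature.Geometry.Lorentzian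

namespace Kerr

namespace Ingoing

variable {M a rm : ℝ} {u : E4}

/-! ### Listed two-variable polynomials in the `HasGrad` calculus (powers: `HasGrad.pow` of `KerrKillingTangency.lean`) -/

/-- A polynomial in `(r, μ) = (u 1, u 2)` presented as a list of monomials `(c, i, j) ↦ c rⁱ μʲ`
(the coefficients `c` are real expressions in the parameters). [folklore] -/
def poly2 (l : List (ℝ × ℕ × ℕ)) (u : E4) : ℝ :=
  (l.map fun t ↦ t.1 * u 1 ^ t.2.1 * u 2 ^ t.2.2).sum

/-- The `∂_r`-list. [folklore] -/
def poly2R (l : List (ℝ × ℕ × ℕ)) : List (ℝ × ℕ × ℕ) :=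
  l.map fun t ↦ (t.1 * t.2.1, t.2.1 - 1, t.2.2)

/-- The `∂_μ`-list. [folklore] -/
def poly2M (l : List (ℝ × ℕ × ℕ)) : List (ℝ × ℕ × ℕ) :=
  l.map fun t ↦ (t.1 * t.2.2, t.2.1, t.2.2 - 1)

/-- The empty list is the zero polynomial. [folklore] -/
@[simp] theorem poly2_nil (u : E4) : poly2 [] u = 0 := by simp [poly2]

/-- Unfolding a listed polynomial one monomial at a time. [folklore] -/
@[simp] theorem poly2_cons (t : ℝ × ℕ × ℕ) (l : List (ℝ × ℕ × ℕ)) (u : E4) :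
    poly2 (t :: l) u = t.1 * u 1 ^ t.2.1 * u 2 ^ t.2.2 + poly2 l u := by
  simp [poly2]

/-- Gradient of a monomial. [folklore] -/
theorem hasGrad_monomial (c : ℝ) (i j : ℕ) (u : E4) :
    HasGrad (fun u : E4 ↦ c * u 1 ^ i * u 2 ^ j) u (c * i * u 1 ^ (i - 1) * u 2 ^ j)
      (c * j * u 1 ^ i * u 2 ^ (j - 1)) := by
  have h := (((HasGrad.fst u).pow i).const_mul c).mul ((HasGrad.snd u).pow j)
  refine h.congr ?_ ?_ <;> ring

/-- **Gradient of a listed polynomial**: `∂_r`, `∂_μ` act termwise. [folklore] -/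
theorem hasGrad_poly2 (l : List (ℝ × ℕ × ℕ)) (u : E4) :
    HasGrad (poly2 l) u (poly2 (poly2R l) u) (poly2 (poly2M l) u) := by
  induction l with
  | nil =>
    have h := HasGrad.const u (0 : ℝ)
    have he : (fun _ : E4 ↦ (0 : ℝ)) = poly2 [] := by funext v; simp
    rw [he] at h
    refine h.congr ?_ ?_ <;> simp [poly2R, poly2M]
  | cons t l ih =>
    have h := (hasGrad_monomial t.1 t.2.1 t.2.2 u).add ih
    have he : (fun u : E4 ↦ t.1 * u 1 ^ t.2.1 * u 2 ^ t.2.2 + poly2 l u) = poly2 (t :: l) := by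
      funext v; rw [poly2_cons]
    rw [he] at h
    refine h.congr ?_ ?_
    · simp [poly2R, poly2]
    · simp [poly2M, poly2]

/-- Gradient of a listed polynomial over a product of powers of the atoms `Σ`, `1 − μ²`, `r − r₋`
(quotient rule; the denominators of all closed forms below have this shape). [folklore] -/
theorem hasGrad_poly2_div (l : List (ℝ × ℕ × ℕ)) (p q s : ℕ) (hS : sigma a u ≠ 0) (hP : sinSq u ≠ 0)
    (hr : u 1 - rm ≠ 0) :
    HasGrad (fun u ↦ poly2 l u / (sigma a u ^ p * sinSq u ^ q * (u 1 - rm) ^ s)) u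
      ((poly2 (poly2R l) u * (sigma a u ^ p * sinSq u ^ q * (u 1 - rm) ^ s)
        - poly2 l u * ((p * sigma a u ^ (p - 1) * (2 * u 1) * sinSq u ^ q
            + sigma a u ^ p * (q * sinSq u ^ (q - 1) * 0)) * (u 1 - rm) ^ s
            + sigma a u ^ p * sinSq u ^ q * (s * (u 1 - rm) ^ (s - 1) * (1 - 0))))
        / (sigma a u ^ p * sinSq u ^ q * (u 1 - rm) ^ s) ^ 2)
      ((poly2 (poly2M l) u * (sigma a u ^ p * sinSq u ^ q * (u 1 - rm) ^ s)
        - poly2 l u * ((p * sigma a u ^ (p - 1) * (2 * a ^ 2 * u 2) * sinSq u ^ q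
            + sigma a u ^ p * (q * sinSq u ^ (q - 1) * (-(2 * u 2)))) * (u 1 - rm) ^ s
            + sigma a u ^ p * sinSq u ^ q * (s * (u 1 - rm) ^ (s - 1) * (0 - 0))))
        / (sigma a u ^ p * sinSq u ^ q * (u 1 - rm) ^ s) ^ 2) := by
  have hD : sigma a u ^ p * sinSq u ^ q * (u 1 - rm) ^ s ≠ 0 :=
    mul_ne_zero (mul_ne_zero (pow_ne_zero _ hS) (pow_ne_zero _ hP)) (pow_ne_zero _ hr)
  have hden := (((hasGrad_sigma a u).pow p).mul ((hasGrad_sinSq u).pow q)).mul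
    (((HasGrad.fst u).sub (HasGrad.const u rm)).pow s)
  exact (hasGrad_poly2 l u).div hden hD

/-! ### The coordinate basis and the Christoffel coefficients -/

/-- The coordinate basis of `E4` as a `Module.Basis` (the basis argument of `MetricCoord.tcov`).
[folklore] -/
abbrev bF : Basis (Fin 4) ℝ E4 := (EuclideanSpace.basisFun (Fin 4) ℝ).toBasis

/-- The coordinate basis vectors are the `∂_i`. [folklore] -/
theorem bF_apply (i : Fin 4) : bF i = E4.basisVector i := basisFun_toBasis_apply i

/-- `Γ^m_{ji}` in the coordinate basis is the `m`-th component of the closed-form vector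
`Γ(∂_j, ∂_i)` of `KerrIngoingCoordConnection(II).lean`. [cite: ONeill1983, Ch. 3, Prop. 3.13] -/
theorem chrCoef_bF (M a : ℝ) (u : E4) (j i m : Fin 4) :
    chrCoef (bilin M a) bF u j i m = (chrAt (bilin M a) u (E4.basisVector j) (E4.basisVector i)) m := by
  unfold chrCoef
  rw [bF_apply, bF_apply, basisFun_toBasis_coord]

variable (M a) in
/-- `Γ(∂_j, ∂_i) = Γ(∂_i, ∂_j)` for the Kerr components (torsion-freeness), the six instances
reducing to the tree's closed forms with `i ≤ j`. [cite: ONeill1983, Ch. 3, Prop. 3.13] -/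
theorem chrAt_bv_swap (hu : u ∈ regularSet a) (j i : Fin 4) :
    chrAt (bilin M a) u (E4.basisVector j) (E4.basisVector i) =
      chrAt (bilin M a) u (E4.basisVector i) (E4.basisVector j) :=
  (isMetricOn_bilin M a).chrAt_comm hu _ _

/-! ### The 1-form `ω₍₀₎` and its first derivatives -/

/-- **Hintz's / AHW's zero-energy gauge potential** `ω₍₀₎` in the ingoing Kerr coordinates
`u = (t*, r, μ, φ)` of `KerrIngoingCoordMetric.lean`, as a rank-one component field
(`ω_i = omega0 a rm u (uidx i)`):
`ω₍₀₎ = (r/Σ) dt* + (r/Σ − 1/(r − r₋)) dr − (a r (1−μ²)/Σ) dφ`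
(`= (r/ϱ²)(dt₀ − a sin²θ dφ₀) + ((r₊ − r)/Δ) dr` with `dt₀ = dt* + dr`, `(r₊ − r)/Δ = −1/(r − r₋)`).
The parameter `rm` is `r₋`; the relation `r₋² − 2M r₋ + a² = 0` is imposed in the theorems.
[cite: Hintz2026, Lemma 6.10] -/
def omega0 (a rm : ℝ) : E4 → (Unit → Fin 4) → ℝ := fun u I ↦
  ![u 1 / sigma a u, u 1 / sigma a u - 1 / (u 1 - rm), 0, -(a * u 1 * sinSq u) / sigma a u] (I ())

/-- `ω_{t*} = r/Σ`. [cite: Hintz2026, Lemma 6.10] -/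
@[simp] theorem omega0_uidx_0 (u : E4) : omega0 a rm u (uidx 0) = u 1 / sigma a u := rfl
/-- `ω_r = r/Σ − 1/(r − r₋)`. [cite: Hintz2026, Lemma 6.10] -/
@[simp] theorem omega0_uidx_1 (u : E4) :
    omega0 a rm u (uidx 1) = u 1 / sigma a u - 1 / (u 1 - rm) := rfl
/-- `ω_μ = 0`. [cite: Hintz2026, Lemma 6.10] -/
@[simp] theorem omega0_uidx_2 (u : E4) : omega0 a rm u (uidx 2) = 0 := rfl
/-- `ω_φ = −a r (1 − μ²)/Σ`. [cite: Hintz2026, Lemma 6.10] -/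
@[simp] theorem omega0_uidx_3 (u : E4) :
    omega0 a rm u (uidx 3) = -(a * u 1 * sinSq u) / sigma a u := rfl

/-- `∂_r ω_i` in closed form. [cite: Hintz2026, Lemma 6.10] -/
def omR (a rm : ℝ) (u : E4) : Fin 4 → ℝ :=
  ![(sigma a u - 2 * u 1 ^ 2) / sigma a u ^ 2,
    (sigma a u - 2 * u 1 ^ 2) / sigma a u ^ 2 + 1 / (u 1 - rm) ^ 2,
    0,
    -(a * sinSq u * (sigma a u - 2 * u 1 ^ 2)) / sigma a u ^ 2]

/-- `∂_μ ω_i` in closed form. [cite: Hintz2026, Lemma 6.10] -/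
def omM (a : ℝ) (u : E4) : Fin 4 → ℝ :=
  ![-(2 * a ^ 2 * u 1 * u 2) / sigma a u ^ 2,
    -(2 * a ^ 2 * u 1 * u 2) / sigma a u ^ 2,
    0,
    2 * a * u 1 * u 2 * (u 1 ^ 2 + a ^ 2) / sigma a u ^ 2]

/-- The gradients of the components of `ω₍₀₎`. [folklore] -/
theorem hasGrad_omega0 (hS : sigma a u ≠ 0) (hr : u 1 - rm ≠ 0) (i : Fin 4) :
    HasGrad (fun y ↦ omega0 a rm y (uidx i)) u (omR a rm u i) (omM a u i) := by
  fin_cases i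
  · simp only [Fin.zero_eta, Fin.isValue, omega0_uidx_0]
    have h := (HasGrad.fst u).div (hasGrad_sigma a u) hS
    refine h.congr ?_ ?_
    · simp only [omR, Fin.isValue, Matrix.cons_val_zero]; ring
    · simp only [omM, Fin.isValue, Matrix.cons_val_zero]; ring
  · simp only [Fin.mk_one, Fin.isValue, omega0_uidx_1]
    have h := ((HasGrad.fst u).div (hasGrad_sigma a u) hS).sub
      ((HasGrad.const u 1).div ((HasGrad.fst u).sub (HasGrad.const u rm)) hr)
    refine h.congr ?_ ?_
    · simp only [omR, Fin.isValue, Matrix.cons_val_one, Matrix.cons_val_zero]; ring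
    · simp only [omM, Fin.isValue, Matrix.cons_val_one, Matrix.cons_val_zero]; ring
  · simp only [Fin.reduceFinMk, Fin.isValue, omega0_uidx_2]
    refine (HasGrad.const u 0).congr ?_ ?_ <;> simp [omR, omM]
  · simp only [Fin.reduceFinMk, Fin.isValue, omega0_uidx_3]
    have h := ((((HasGrad.fst u).const_mul a).mul (hasGrad_sinSq u)).neg).div (hasGrad_sigma a u) hS
    refine h.congr ?_ ?_
    · simp only [omR, Fin.isValue, Matrix.cons_val]; ring
    · simp only [omM, Fin.isValue, Matrix.cons_val, sigma, sinSq]; ring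

/-- `∂_V ω_i = (∂_r ω_i) V¹ + (∂_μ ω_i) V²`. [folklore] -/
theorem fderiv_omega0 (hS : sigma a u ≠ 0) (hr : u 1 - rm ≠ 0) (i : Fin 4) (V : E4) :
    fderiv ℝ (fun y ↦ omega0 a rm y (uidx i)) u V = omR a rm u i * V 1 + omM a u i * V 2 :=
  (hasGrad_omega0 hS hr i).fderiv_apply V

/-- The components of `ω₍₀₎` are `C^∞` on `{Σ ≠ 0, μ² ≠ 1, r ≠ r₋}`. [folklore] -/
theorem tsmoothOn_omega0 (a rm : ℝ) :
    TSmoothOn (omega0 a rm) (regularSet a ∩ {u | u 1 ≠ rm}) := by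
  intro I
  rw [← uidx_eta I]
  generalize I () = i
  have hc : ∀ k, ContDiff ℝ ∞ fun w : E4 ↦ w k := contDiff_euclidean.1 contDiff_id
  have hSig : ContDiff ℝ ∞ (sigma a) := by unfold sigma; fun_prop
  have hsq : ContDiff ℝ ∞ sinSq := by unfold sinSq; fun_prop
  fin_cases i
  · simp only [Fin.zero_eta, Fin.isValue, omega0_uidx_0]
    exact ((hc 1).contDiffOn).div hSig.contDiffOn fun y hy ↦ hy.1.1
  · simp only [Fin.mk_one, Fin.isValue, omega0_uidx_1]
    refine (((hc 1).contDiffOn).div hSig.contDiffOn fun y hy ↦ hy.1.1).sub ?_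
    exact contDiffOn_const.div (((hc 1).sub contDiff_const).contDiffOn)
      fun y hy ↦ sub_ne_zero.mpr hy.2
  · simp only [Fin.reduceFinMk, Fin.isValue, omega0_uidx_2]
    exact contDiffOn_const
  · simp only [Fin.reduceFinMk, Fin.isValue, omega0_uidx_3]
    exact ((((contDiff_const.mul (hc 1)).mul hsq).neg).contDiffOn).div hSig.contDiffOn
      fun y hy ↦ hy.1.1

/-- The set `{Σ ≠ 0, μ² ≠ 1, r ≠ r₋}` is open. [folklore] -/
theorem isOpen_regularSet_inter (a rm : ℝ) : IsOpen (regularSet a ∩ {u : E4 | u 1 ≠ rm}) := by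
  have h1 : Continuous fun w : E4 ↦ w 1 := by fun_prop
  exact (isOpen_regularSet a).inter (isOpen_ne_fun h1 continuous_const)

/-! ### The closed forms of `∇ω₍₀₎` and of its first derivatives (generated, exact) -/
/-- numerator list of `(∇ω₍₀₎)_{00}` (generated by exact rational arithmetic, checked below by Lean). [cite: Hintz2026, Lemma 6.10] -/
def cN00 (M a rm : ℝ) : List (ℝ × ℕ × ℕ) :=
  [((-2 : ℝ) * M ^ 2 + (1 : ℝ) * M * rm, 3, 0),
      ((1 : ℝ) * a ^ 2 * M, 2, 0),
      ((2 : ℝ) * a ^ 2 * M ^ 2 + (-1 : ℝ) * a ^ 2 * M * rm, 1, 2),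
      ((-1 : ℝ) * a ^ 4 * M, 0, 2)]
/-- numerator list of `(∇ω₍₀₎)_{01}` (generated by exact rational arithmetic, checked below by Lean). [cite: Hintz2026, Lemma 6.10] -/
def cN01 (M a rm : ℝ) : List (ℝ × ℕ × ℕ) :=
  [((-1 : ℝ) * M, 4, 0),
      ((-2 : ℝ) * M ^ 2 + (1 : ℝ) * M * rm, 3, 0),
      ((1 : ℝ) * a ^ 2 * M, 2, 0),
      ((2 : ℝ) * a ^ 2 * M ^ 2 + (-1 : ℝ) * a ^ 2 * M * rm, 1, 2),
      ((1 : ℝ) * a ^ 4 * M, 0, 4),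
      ((-1 : ℝ) * a ^ 4 * M, 0, 2)]
/-- numerator list of `(∇ω₍₀₎)_{03}` (generated by exact rational arithmetic, checked below by Lean). [cite: Hintz2026, Lemma 6.10] -/
def cN03 (M a rm : ℝ) : List (ℝ × ℕ × ℕ) :=
  [((-2 : ℝ) * a * M ^ 2 + (1 : ℝ) * a * M * rm, 3, 2),
      ((2 : ℝ) * a * M ^ 2 + (-1 : ℝ) * a * M * rm, 3, 0),
      ((1 : ℝ) * a ^ 3 * M, 2, 2),
      ((-1 : ℝ) * a ^ 3 * M, 2, 0),
      ((2 : ℝ) * a ^ 3 * M ^ 2 + (-1 : ℝ) * a ^ 3 * M * rm, 1, 4),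
      ((-2 : ℝ) * a ^ 3 * M ^ 2 + (1 : ℝ) * a ^ 3 * M * rm, 1, 2),
      ((-1 : ℝ) * a ^ 5 * M, 0, 4),
      ((1 : ℝ) * a ^ 5 * M, 0, 2)]
/-- numerator list of `(∇ω₍₀₎)_{10}` (generated by exact rational arithmetic, checked below by Lean). [cite: Hintz2026, Lemma 6.10] -/
def cN10 (M a rm : ℝ) : List (ℝ × ℕ × ℕ) :=
  [((-1 : ℝ), 5, 0),
      ((-1 : ℝ) * M + (1 : ℝ) * rm, 4, 0),
      ((-2 : ℝ) * M ^ 2 + (1 : ℝ) * M * rm, 3, 0),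
      ((1 : ℝ) * a ^ 2 * M, 2, 0),
      ((1 : ℝ) * a ^ 4, 1, 4),
      ((2 : ℝ) * a ^ 2 * M ^ 2 + (-1 : ℝ) * a ^ 2 * M * rm, 1, 2),
      ((1 : ℝ) * a ^ 4 * M + (-1 : ℝ) * a ^ 4 * rm, 0, 4),
      ((-1 : ℝ) * a ^ 4 * M, 0, 2)]
/-- numerator list of `(∇ω₍₀₎)_{11}` (generated by exact rational arithmetic, checked below by Lean). [cite: Hintz2026, Lemma 6.10] -/
def cN11 (M a rm : ℝ) : List (ℝ × ℕ × ℕ) :=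
  [((-2 : ℝ) * M + (2 : ℝ) * rm, 5, 0),
      ((3 : ℝ) * a ^ 2, 4, 2),
      ((-2 : ℝ) * M ^ 2 + (3 : ℝ) * M * rm + (-1 : ℝ) * rm ^ 2, 4, 0),
      ((1 : ℝ) * a ^ 2 * M + (2 : ℝ) * M ^ 2 * rm + (-1 : ℝ) * M * rm ^ 2, 3, 0),
      ((4 : ℝ) * a ^ 4, 2, 4),
      ((2 : ℝ) * a ^ 2 * M ^ 2 + (-1 : ℝ) * a ^ 2 * M * rm, 2, 2),
      ((-1 : ℝ) * a ^ 2 * M * rm, 2, 0),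
      ((2 : ℝ) * a ^ 4 * M + (-2 : ℝ) * a ^ 4 * rm, 1, 4),
      ((-1 : ℝ) * a ^ 4 * M + (-2 : ℝ) * a ^ 2 * M ^ 2 * rm + (1 : ℝ) * a ^ 2 * M * rm ^ 2, 1, 2),
      ((1 : ℝ) * a ^ 6, 0, 6),
      ((-2 : ℝ) * a ^ 4 * M * rm + (1 : ℝ) * a ^ 4 * rm ^ 2, 0, 4),
      ((1 : ℝ) * a ^ 4 * M * rm, 0, 2)]
/-- numerator list of `(∇ω₍₀₎)_{12}` (generated by exact rational arithmetic, checked below by Lean). [cite: Hintz2026, Lemma 6.10] -/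
def cN12 (a : ℝ) : List (ℝ × ℕ × ℕ) :=
  [((1 : ℝ) * a ^ 2, 0, 1)]
/-- numerator list of `(∇ω₍₀₎)_{13}` (generated by exact rational arithmetic, checked below by Lean). [cite: Hintz2026, Lemma 6.10] -/
def cN13 (M a rm : ℝ) : List (ℝ × ℕ × ℕ) :=
  [((-2 : ℝ) * a, 5, 2),
      ((2 : ℝ) * a, 5, 0),
      ((-1 : ℝ) * a * M + (1 : ℝ) * a * rm, 4, 2),
      ((1 : ℝ) * a * M + (-1 : ℝ) * a * rm, 4, 0),
      ((-2 : ℝ) * a ^ 3, 3, 4),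
      ((2 : ℝ) * a ^ 3 + (-2 : ℝ) * a * M ^ 2 + (1 : ℝ) * a * M * rm, 3, 2),
      ((2 : ℝ) * a * M ^ 2 + (-1 : ℝ) * a * M * rm, 3, 0),
      ((1 : ℝ) * a ^ 3 * M, 2, 2),
      ((-1 : ℝ) * a ^ 3 * M, 2, 0),
      ((2 : ℝ) * a ^ 3 * M ^ 2 + (-1 : ℝ) * a ^ 3 * M * rm, 1, 4),
      ((-2 : ℝ) * a ^ 3 * M ^ 2 + (1 : ℝ) * a ^ 3 * M * rm, 1, 2),
      ((1 : ℝ) * a ^ 5 * M + (-1 : ℝ) * a ^ 5 * rm, 0, 6),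
      ((-2 : ℝ) * a ^ 5 * M + (1 : ℝ) * a ^ 5 * rm, 0, 4),
      ((1 : ℝ) * a ^ 5 * M, 0, 2)]
/-- numerator list of `(∇ω₍₀₎)_{20}` (generated by exact rational arithmetic, checked below by Lean). [cite: Hintz2026, Lemma 6.10] -/
def cN20 (a : ℝ) : List (ℝ × ℕ × ℕ) :=
  [((-2 : ℝ) * a ^ 2, 1, 1)]
/-- numerator list of `(∇ω₍₀₎)_{21}` (generated by exact rational arithmetic, checked below by Lean). [cite: Hintz2026, Lemma 6.10] -/
def cN21 (a rm : ℝ) : List (ℝ × ℕ × ℕ) :=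
  [((-1 : ℝ) * a ^ 2, 2, 1),
      ((2 : ℝ) * a ^ 2 * rm, 1, 1),
      ((1 : ℝ) * a ^ 4, 0, 3)]
/-- numerator list of `(∇ω₍₀₎)_{22}` (generated by exact rational arithmetic, checked below by Lean). [cite: Hintz2026, Lemma 6.10] -/
def cN22 (M a rm : ℝ) : List (ℝ × ℕ × ℕ) :=
  [((2 : ℝ) * M + (-1 : ℝ) * rm, 2, 0),
      ((-1 : ℝ) * a ^ 2, 1, 0)]
/-- numerator list of `(∇ω₍₀₎)_{23}` (generated by exact rational arithmetic, checked below by Lean). [cite: Hintz2026, Lemma 6.10] -/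
def cN23 (a : ℝ) : List (ℝ × ℕ × ℕ) :=
  [((1 : ℝ) * a, 3, 1),
      ((-1 : ℝ) * a ^ 3, 1, 3),
      ((2 : ℝ) * a ^ 3, 1, 1)]
/-- numerator list of `(∇ω₍₀₎)_{30}` (generated by exact rational arithmetic, checked below by Lean). [cite: Hintz2026, Lemma 6.10] -/
def cN30 (M a rm : ℝ) : List (ℝ × ℕ × ℕ) :=
  [((-2 : ℝ) * a * M ^ 2 + (1 : ℝ) * a * M * rm, 3, 2),
      ((2 : ℝ) * a * M ^ 2 + (-1 : ℝ) * a * M * rm, 3, 0),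
      ((1 : ℝ) * a ^ 3 * M, 2, 2),
      ((-1 : ℝ) * a ^ 3 * M, 2, 0),
      ((2 : ℝ) * a ^ 3 * M ^ 2 + (-1 : ℝ) * a ^ 3 * M * rm, 1, 4),
      ((-2 : ℝ) * a ^ 3 * M ^ 2 + (1 : ℝ) * a ^ 3 * M * rm, 1, 2),
      ((-1 : ℝ) * a ^ 5 * M, 0, 4),
      ((1 : ℝ) * a ^ 5 * M, 0, 2)]
/-- numerator list of `(∇ω₍₀₎)_{31}` (generated by exact rational arithmetic, checked below by Lean). [cite: Hintz2026, Lemma 6.10] -/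
def cN31 (M a rm : ℝ) : List (ℝ × ℕ × ℕ) :=
  [((-1 : ℝ) * a, 5, 2),
      ((1 : ℝ) * a, 5, 0),
      ((-1 : ℝ) * a * M, 4, 2),
      ((1 : ℝ) * a * M, 4, 0),
      ((-2 : ℝ) * a ^ 3, 3, 4),
      ((2 : ℝ) * a ^ 3 + (-2 : ℝ) * a * M ^ 2 + (1 : ℝ) * a * M * rm, 3, 2),
      ((2 : ℝ) * a * M ^ 2 + (-1 : ℝ) * a * M * rm, 3, 0),
      ((1 : ℝ) * a ^ 3 * M, 2, 2),
      ((-1 : ℝ) * a ^ 3 * M, 2, 0),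
      ((-1 : ℝ) * a ^ 5, 1, 6),
      ((1 : ℝ) * a ^ 5 + (2 : ℝ) * a ^ 3 * M ^ 2 + (-1 : ℝ) * a ^ 3 * M * rm, 1, 4),
      ((-2 : ℝ) * a ^ 3 * M ^ 2 + (1 : ℝ) * a ^ 3 * M * rm, 1, 2),
      ((1 : ℝ) * a ^ 5 * M, 0, 6),
      ((-2 : ℝ) * a ^ 5 * M, 0, 4),
      ((1 : ℝ) * a ^ 5 * M, 0, 2)]
/-- numerator list of `(∇ω₍₀₎)_{32}` (generated by exact rational arithmetic, checked below by Lean). [cite: Hintz2026, Lemma 6.10] -/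
def cN32 (a : ℝ) : List (ℝ × ℕ × ℕ) :=
  [((-1 : ℝ) * a, 1, 1)]
/-- numerator list of `(∇ω₍₀₎)_{33}` (generated by exact rational arithmetic, checked below by Lean). [cite: Hintz2026, Lemma 6.10] -/
def cN33 (M a rm : ℝ) : List (ℝ × ℕ × ℕ) :=
  [((-2 : ℝ) * M + (1 : ℝ) * rm, 6, 2),
      ((2 : ℝ) * M + (-1 : ℝ) * rm, 6, 0),
      ((1 : ℝ) * a ^ 2, 5, 2),
      ((-1 : ℝ) * a ^ 2, 5, 0),
      ((-4 : ℝ) * a ^ 2 * M + (2 : ℝ) * a ^ 2 * rm, 4, 4),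
      ((4 : ℝ) * a ^ 2 * M + (-2 : ℝ) * a ^ 2 * rm, 4, 2),
      ((2 : ℝ) * a ^ 4 + (-2 : ℝ) * a ^ 2 * M ^ 2 + (1 : ℝ) * a ^ 2 * M * rm, 3, 4),
      ((-2 : ℝ) * a ^ 4 + (4 : ℝ) * a ^ 2 * M ^ 2 + (-2 : ℝ) * a ^ 2 * M * rm, 3, 2),
      ((-2 : ℝ) * a ^ 2 * M ^ 2 + (1 : ℝ) * a ^ 2 * M * rm, 3, 0),
      ((-2 : ℝ) * a ^ 4 * M + (1 : ℝ) * a ^ 4 * rm, 2, 6),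
      ((3 : ℝ) * a ^ 4 * M + (-1 : ℝ) * a ^ 4 * rm, 2, 4),
      ((-2 : ℝ) * a ^ 4 * M, 2, 2),
      ((1 : ℝ) * a ^ 4 * M, 2, 0),
      ((1 : ℝ) * a ^ 6 + (2 : ℝ) * a ^ 4 * M ^ 2 + (-1 : ℝ) * a ^ 4 * M * rm, 1, 6),
      ((-1 : ℝ) * a ^ 6 + (-4 : ℝ) * a ^ 4 * M ^ 2 + (2 : ℝ) * a ^ 4 * M * rm, 1, 4),
      ((2 : ℝ) * a ^ 4 * M ^ 2 + (-1 : ℝ) * a ^ 4 * M * rm, 1, 2),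
      ((-1 : ℝ) * a ^ 6 * M, 0, 6),
      ((2 : ℝ) * a ^ 6 * M, 0, 4),
      ((-1 : ℝ) * a ^ 6 * M, 0, 2)]
/-- numerator list of `∂_r (∇ω₍₀₎)_{00}` (generated by exact rational arithmetic, checked below by Lean). [cite: Hintz2026, Lemma 6.10] -/
def dNR00 (M a rm : ℝ) : List (ℝ × ℕ × ℕ) :=
  [((8 : ℝ) * M ^ 2 + (-4 : ℝ) * M * rm, 5, 0),
      ((-5 : ℝ) * a ^ 2 * M + (-6 : ℝ) * M ^ 2 * rm + (3 : ℝ) * M * rm ^ 2, 4, 0),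
      ((-16 : ℝ) * a ^ 2 * M ^ 2 + (8 : ℝ) * a ^ 2 * M * rm, 3, 2),
      ((4 : ℝ) * a ^ 2 * M * rm, 3, 0),
      ((8 : ℝ) * a ^ 4 * M + (16 : ℝ) * a ^ 2 * M ^ 2 * rm + (-8 : ℝ) * a ^ 2 * M * rm ^ 2, 2, 2),
      ((-8 : ℝ) * a ^ 4 * M * rm, 1, 2),
      ((1 : ℝ) * a ^ 6 * M + (-2 : ℝ) * a ^ 4 * M ^ 2 * rm + (1 : ℝ) * a ^ 4 * M * rm ^ 2, 0, 4)]
/-- numerator list of `∂_μ (∇ω₍₀₎)_{00}` (generated by exact rational arithmetic, checked below by Lean). [cite: Hintz2026, Lemma 6.10] -/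
def dNMu00 (M a rm : ℝ) : List (ℝ × ℕ × ℕ) :=
  [((16 : ℝ) * a ^ 2 * M ^ 2 + (-8 : ℝ) * a ^ 2 * M * rm, 3, 1),
      ((-8 : ℝ) * a ^ 4 * M, 2, 1),
      ((-8 : ℝ) * a ^ 4 * M ^ 2 + (4 : ℝ) * a ^ 4 * M * rm, 1, 3),
      ((4 : ℝ) * a ^ 6 * M, 0, 3)]
/-- numerator list of `∂_r (∇ω₍₀₎)_{01}` (generated by exact rational arithmetic, checked below by Lean). [cite: Hintz2026, Lemma 6.10] -/
def dNR01 (M a rm : ℝ) : List (ℝ × ℕ × ℕ) :=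
  [((3 : ℝ) * M, 6, 0),
      ((8 : ℝ) * M ^ 2 + (-6 : ℝ) * M * rm, 5, 0),
      ((-3 : ℝ) * a ^ 2 * M, 4, 2),
      ((-5 : ℝ) * a ^ 2 * M + (-6 : ℝ) * M ^ 2 * rm + (3 : ℝ) * M * rm ^ 2, 4, 0),
      ((-16 : ℝ) * a ^ 2 * M ^ 2 + (12 : ℝ) * a ^ 2 * M * rm, 3, 2),
      ((4 : ℝ) * a ^ 2 * M * rm, 3, 0),
      ((-7 : ℝ) * a ^ 4 * M, 2, 4),
      ((8 : ℝ) * a ^ 4 * M + (16 : ℝ) * a ^ 2 * M ^ 2 * rm + (-8 : ℝ) * a ^ 2 * M * rm ^ 2, 2, 2),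
      ((6 : ℝ) * a ^ 4 * M * rm, 1, 4),
      ((-8 : ℝ) * a ^ 4 * M * rm, 1, 2),
      ((-1 : ℝ) * a ^ 6 * M, 0, 6),
      ((1 : ℝ) * a ^ 6 * M + (-2 : ℝ) * a ^ 4 * M ^ 2 * rm + (1 : ℝ) * a ^ 4 * M * rm ^ 2, 0, 4)]
/-- numerator list of `∂_μ (∇ω₍₀₎)_{01}` (generated by exact rational arithmetic, checked below by Lean). [cite: Hintz2026, Lemma 6.10] -/
def dNMu01 (M a rm : ℝ) : List (ℝ × ℕ × ℕ) :=
  [((6 : ℝ) * a ^ 2 * M, 4, 1),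
      ((16 : ℝ) * a ^ 2 * M ^ 2 + (-8 : ℝ) * a ^ 2 * M * rm, 3, 1),
      ((4 : ℝ) * a ^ 4 * M, 2, 3),
      ((-8 : ℝ) * a ^ 4 * M, 2, 1),
      ((-8 : ℝ) * a ^ 4 * M ^ 2 + (4 : ℝ) * a ^ 4 * M * rm, 1, 3),
      ((-2 : ℝ) * a ^ 6 * M, 0, 5),
      ((4 : ℝ) * a ^ 6 * M, 0, 3)]
/-- numerator list of `∂_r (∇ω₍₀₎)_{03}` (generated by exact rational arithmetic, checked below by Lean). [cite: Hintz2026, Lemma 6.10] -/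
def dNR03 (M a rm : ℝ) : List (ℝ × ℕ × ℕ) :=
  [((8 : ℝ) * a * M ^ 2 + (-4 : ℝ) * a * M * rm, 5, 2),
      ((-8 : ℝ) * a * M ^ 2 + (4 : ℝ) * a * M * rm, 5, 0),
      ((-5 : ℝ) * a ^ 3 * M + (-6 : ℝ) * a * M ^ 2 * rm + (3 : ℝ) * a * M * rm ^ 2, 4, 2),
      ((5 : ℝ) * a ^ 3 * M + (6 : ℝ) * a * M ^ 2 * rm + (-3 : ℝ) * a * M * rm ^ 2, 4, 0),
      ((-16 : ℝ) * a ^ 3 * M ^ 2 + (8 : ℝ) * a ^ 3 * M * rm, 3, 4),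
      ((16 : ℝ) * a ^ 3 * M ^ 2 + (-4 : ℝ) * a ^ 3 * M * rm, 3, 2),
      ((-4 : ℝ) * a ^ 3 * M * rm, 3, 0),
      ((8 : ℝ) * a ^ 5 * M + (16 : ℝ) * a ^ 3 * M ^ 2 * rm + (-8 : ℝ) * a ^ 3 * M * rm ^ 2, 2, 4),
      ((-8 : ℝ) * a ^ 5 * M + (-16 : ℝ) * a ^ 3 * M ^ 2 * rm + (8 : ℝ) * a ^ 3 * M * rm ^ 2, 2, 2),
      ((-8 : ℝ) * a ^ 5 * M * rm, 1, 4),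
      ((8 : ℝ) * a ^ 5 * M * rm, 1, 2),
      ((1 : ℝ) * a ^ 7 * M + (-2 : ℝ) * a ^ 5 * M ^ 2 * rm + (1 : ℝ) * a ^ 5 * M * rm ^ 2, 0, 6),
      ((-1 : ℝ) * a ^ 7 * M + (2 : ℝ) * a ^ 5 * M ^ 2 * rm + (-1 : ℝ) * a ^ 5 * M * rm ^ 2, 0, 4)]
/-- numerator list of `∂_μ (∇ω₍₀₎)_{03}` (generated by exact rational arithmetic, checked below by Lean). [cite: Hintz2026, Lemma 6.10] -/
def dNMu03 (M a rm : ℝ) : List (ℝ × ℕ × ℕ) :=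
  [((-4 : ℝ) * a * M ^ 2 + (2 : ℝ) * a * M * rm, 5, 1),
      ((2 : ℝ) * a ^ 3 * M, 4, 1),
      ((16 : ℝ) * a ^ 3 * M ^ 2 + (-8 : ℝ) * a ^ 3 * M * rm, 3, 3),
      ((-16 : ℝ) * a ^ 3 * M ^ 2 + (8 : ℝ) * a ^ 3 * M * rm, 3, 1),
      ((-8 : ℝ) * a ^ 5 * M, 2, 3),
      ((8 : ℝ) * a ^ 5 * M, 2, 1),
      ((-4 : ℝ) * a ^ 5 * M ^ 2 + (2 : ℝ) * a ^ 5 * M * rm, 1, 5),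
      ((8 : ℝ) * a ^ 5 * M ^ 2 + (-4 : ℝ) * a ^ 5 * M * rm, 1, 3),
      ((2 : ℝ) * a ^ 7 * M, 0, 5),
      ((-4 : ℝ) * a ^ 7 * M, 0, 3)]
/-- numerator list of `∂_r (∇ω₍₀₎)_{10}` (generated by exact rational arithmetic, checked below by Lean). [cite: Hintz2026, Lemma 6.10] -/
def dNR10 (M a rm : ℝ) : List (ℝ × ℕ × ℕ) :=
  [((2 : ℝ), 7, 0),
      ((3 : ℝ) * M + (-4 : ℝ) * rm, 6, 0),
      ((-4 : ℝ) * a ^ 2, 5, 2),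
      ((8 : ℝ) * M ^ 2 + (-6 : ℝ) * M * rm + (2 : ℝ) * rm ^ 2, 5, 0),
      ((-3 : ℝ) * a ^ 2 * M + (8 : ℝ) * a ^ 2 * rm, 4, 2),
      ((-5 : ℝ) * a ^ 2 * M + (-6 : ℝ) * M ^ 2 * rm + (3 : ℝ) * M * rm ^ 2, 4, 0),
      ((-6 : ℝ) * a ^ 4, 3, 4),
      ((-16 : ℝ) * a ^ 2 * M ^ 2 + (12 : ℝ) * a ^ 2 * M * rm + (-4 : ℝ) * a ^ 2 * rm ^ 2, 3, 2),
      ((4 : ℝ) * a ^ 2 * M * rm, 3, 0),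
      ((-7 : ℝ) * a ^ 4 * M + (12 : ℝ) * a ^ 4 * rm, 2, 4),
      ((8 : ℝ) * a ^ 4 * M + (16 : ℝ) * a ^ 2 * M ^ 2 * rm + (-8 : ℝ) * a ^ 2 * M * rm ^ 2, 2, 2),
      ((6 : ℝ) * a ^ 4 * M * rm + (-6 : ℝ) * a ^ 4 * rm ^ 2, 1, 4),
      ((-8 : ℝ) * a ^ 4 * M * rm, 1, 2),
      ((-1 : ℝ) * a ^ 6 * M, 0, 6),
      ((1 : ℝ) * a ^ 6 * M + (-2 : ℝ) * a ^ 4 * M ^ 2 * rm + (1 : ℝ) * a ^ 4 * M * rm ^ 2, 0, 4)]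
/-- numerator list of `∂_μ (∇ω₍₀₎)_{10}` (generated by exact rational arithmetic, checked below by Lean). [cite: Hintz2026, Lemma 6.10] -/
def dNMu10 (M a rm : ℝ) : List (ℝ × ℕ × ℕ) :=
  [((6 : ℝ) * a ^ 2, 5, 1),
      ((6 : ℝ) * a ^ 2 * M + (-6 : ℝ) * a ^ 2 * rm, 4, 1),
      ((4 : ℝ) * a ^ 4, 3, 3),
      ((16 : ℝ) * a ^ 2 * M ^ 2 + (-8 : ℝ) * a ^ 2 * M * rm, 3, 1),
      ((4 : ℝ) * a ^ 4 * M + (-4 : ℝ) * a ^ 4 * rm, 2, 3),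
      ((-8 : ℝ) * a ^ 4 * M, 2, 1),
      ((-2 : ℝ) * a ^ 6, 1, 5),
      ((-8 : ℝ) * a ^ 4 * M ^ 2 + (4 : ℝ) * a ^ 4 * M * rm, 1, 3),
      ((-2 : ℝ) * a ^ 6 * M + (2 : ℝ) * a ^ 6 * rm, 0, 5),
      ((4 : ℝ) * a ^ 6 * M, 0, 3)]
/-- numerator list of `∂_r (∇ω₍₀₎)_{11}` (generated by exact rational arithmetic, checked below by Lean). [cite: Hintz2026, Lemma 6.10] -/
def dNR11 (M a rm : ℝ) : List (ℝ × ℕ × ℕ) :=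
  [((6 : ℝ) * M + (-6 : ℝ) * rm, 7, 0),
      ((-12 : ℝ) * a ^ 2, 6, 2),
      ((8 : ℝ) * M ^ 2 + (-14 : ℝ) * M * rm + (6 : ℝ) * rm ^ 2, 6, 0),
      ((-6 : ℝ) * a ^ 2 * M + (12 : ℝ) * a ^ 2 * rm, 5, 2),
      ((-5 : ℝ) * a ^ 2 * M + (-14 : ℝ) * M ^ 2 * rm + (11 : ℝ) * M * rm ^ 2 + (-2 : ℝ) * rm ^ 3, 5, 0),
      ((-18 : ℝ) * a ^ 4, 4, 4),
      ((-16 : ℝ) * a ^ 2 * M ^ 2 + (22 : ℝ) * a ^ 2 * M * rm + (-12 : ℝ) * a ^ 2 * rm ^ 2, 4, 2),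
      ((9 : ℝ) * a ^ 2 * M * rm + (6 : ℝ) * M ^ 2 * rm ^ 2 + (-3 : ℝ) * M * rm ^ 3, 4, 0),
      ((-14 : ℝ) * a ^ 4 * M + (18 : ℝ) * a ^ 4 * rm, 3, 4),
      ((8 : ℝ) * a ^ 4 * M + (32 : ℝ) * a ^ 2 * M ^ 2 * rm + (-24 : ℝ) * a ^ 2 * M * rm ^ 2 + (4 : ℝ) * a ^ 2 * rm ^ 3, 3, 2),
      ((-4 : ℝ) * a ^ 2 * M * rm ^ 2, 3, 0),
      ((-8 : ℝ) * a ^ 6, 2, 6),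
      ((26 : ℝ) * a ^ 4 * M * rm + (-18 : ℝ) * a ^ 4 * rm ^ 2, 2, 4),
      ((-16 : ℝ) * a ^ 4 * M * rm + (-16 : ℝ) * a ^ 2 * M ^ 2 * rm ^ 2 + (8 : ℝ) * a ^ 2 * M * rm ^ 3, 2, 2),
      ((-2 : ℝ) * a ^ 6 * M, 1, 6),
      ((1 : ℝ) * a ^ 6 * M + (-2 : ℝ) * a ^ 4 * M ^ 2 * rm + (-11 : ℝ) * a ^ 4 * M * rm ^ 2 + (6 : ℝ) * a ^ 4 * rm ^ 3, 1, 4),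
      ((8 : ℝ) * a ^ 4 * M * rm ^ 2, 1, 2),
      ((-2 : ℝ) * a ^ 8, 0, 8),
      ((2 : ℝ) * a ^ 6 * M * rm, 0, 6),
      ((-1 : ℝ) * a ^ 6 * M * rm + (2 : ℝ) * a ^ 4 * M ^ 2 * rm ^ 2 + (-1 : ℝ) * a ^ 4 * M * rm ^ 3, 0, 4)]
/-- numerator list of `∂_μ (∇ω₍₀₎)_{11}` (generated by exact rational arithmetic, checked below by Lean). [cite: Hintz2026, Lemma 6.10] -/
def dNMu11 (M a rm : ℝ) : List (ℝ × ℕ × ℕ) :=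
  [((6 : ℝ) * a ^ 2, 5, 1),
      ((12 : ℝ) * a ^ 2 * M + (-6 : ℝ) * a ^ 2 * rm, 4, 1),
      ((4 : ℝ) * a ^ 4, 3, 3),
      ((16 : ℝ) * a ^ 2 * M ^ 2 + (-8 : ℝ) * a ^ 2 * M * rm, 3, 1),
      ((8 : ℝ) * a ^ 4 * M + (-4 : ℝ) * a ^ 4 * rm, 2, 3),
      ((-8 : ℝ) * a ^ 4 * M, 2, 1),
      ((-2 : ℝ) * a ^ 6, 1, 5),
      ((-8 : ℝ) * a ^ 4 * M ^ 2 + (4 : ℝ) * a ^ 4 * M * rm, 1, 3),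
      ((-4 : ℝ) * a ^ 6 * M + (2 : ℝ) * a ^ 6 * rm, 0, 5),
      ((4 : ℝ) * a ^ 6 * M, 0, 3)]
/-- numerator list of `∂_r (∇ω₍₀₎)_{12}` (generated by exact rational arithmetic, checked below by Lean). [cite: Hintz2026, Lemma 6.10] -/
def dNR12 (a rm : ℝ) : List (ℝ × ℕ × ℕ) :=
  [((-3 : ℝ) * a ^ 2, 2, 1),
      ((2 : ℝ) * a ^ 2 * rm, 1, 1),
      ((-1 : ℝ) * a ^ 4, 0, 3)]
/-- numerator list of `∂_μ (∇ω₍₀₎)_{12}` (generated by exact rational arithmetic, checked below by Lean). [cite: Hintz2026, Lemma 6.10] -/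
def dNMu12 (a : ℝ) : List (ℝ × ℕ × ℕ) :=
  [((1 : ℝ) * a ^ 2, 2, 0),
      ((-1 : ℝ) * a ^ 4, 0, 2)]
/-- numerator list of `∂_r (∇ω₍₀₎)_{13}` (generated by exact rational arithmetic, checked below by Lean). [cite: Hintz2026, Lemma 6.10] -/
def dNR13 (M a rm : ℝ) : List (ℝ × ℕ × ℕ) :=
  [((4 : ℝ) * a, 7, 2),
      ((-4 : ℝ) * a, 7, 0),
      ((3 : ℝ) * a * M + (-5 : ℝ) * a * rm, 6, 2),
      ((-3 : ℝ) * a * M + (5 : ℝ) * a * rm, 6, 0),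
      ((8 : ℝ) * a * M ^ 2 + (-6 : ℝ) * a * M * rm + (2 : ℝ) * a * rm ^ 2, 5, 2),
      ((-8 : ℝ) * a * M ^ 2 + (6 : ℝ) * a * M * rm + (-2 : ℝ) * a * rm ^ 2, 5, 0),
      ((-3 : ℝ) * a ^ 3 * M + (7 : ℝ) * a ^ 3 * rm, 4, 4),
      ((-2 : ℝ) * a ^ 3 * M + (-7 : ℝ) * a ^ 3 * rm + (-6 : ℝ) * a * M ^ 2 * rm + (3 : ℝ) * a * M * rm ^ 2, 4, 2),
      ((5 : ℝ) * a ^ 3 * M + (6 : ℝ) * a * M ^ 2 * rm + (-3 : ℝ) * a * M * rm ^ 2, 4, 0),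
      ((-4 : ℝ) * a ^ 5, 3, 6),
      ((4 : ℝ) * a ^ 5 + (-16 : ℝ) * a ^ 3 * M ^ 2 + (12 : ℝ) * a ^ 3 * M * rm + (-4 : ℝ) * a ^ 3 * rm ^ 2, 3, 4),
      ((16 : ℝ) * a ^ 3 * M ^ 2 + (-8 : ℝ) * a ^ 3 * M * rm + (4 : ℝ) * a ^ 3 * rm ^ 2, 3, 2),
      ((-4 : ℝ) * a ^ 3 * M * rm, 3, 0),
      ((-7 : ℝ) * a ^ 5 * M + (13 : ℝ) * a ^ 5 * rm, 2, 6),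
      ((15 : ℝ) * a ^ 5 * M + (-13 : ℝ) * a ^ 5 * rm + (16 : ℝ) * a ^ 3 * M ^ 2 * rm + (-8 : ℝ) * a ^ 3 * M * rm ^ 2, 2, 4),
      ((-8 : ℝ) * a ^ 5 * M + (-16 : ℝ) * a ^ 3 * M ^ 2 * rm + (8 : ℝ) * a ^ 3 * M * rm ^ 2, 2, 2),
      ((6 : ℝ) * a ^ 5 * M * rm + (-6 : ℝ) * a ^ 5 * rm ^ 2, 1, 6),
      ((-14 : ℝ) * a ^ 5 * M * rm + (6 : ℝ) * a ^ 5 * rm ^ 2, 1, 4),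
      ((8 : ℝ) * a ^ 5 * M * rm, 1, 2),
      ((-1 : ℝ) * a ^ 7 * M + (1 : ℝ) * a ^ 7 * rm, 0, 8),
      ((2 : ℝ) * a ^ 7 * M + (-1 : ℝ) * a ^ 7 * rm + (-2 : ℝ) * a ^ 5 * M ^ 2 * rm + (1 : ℝ) * a ^ 5 * M * rm ^ 2, 0, 6),
      ((-1 : ℝ) * a ^ 7 * M + (2 : ℝ) * a ^ 5 * M ^ 2 * rm + (-1 : ℝ) * a ^ 5 * M * rm ^ 2, 0, 4)]
/-- numerator list of `∂_μ (∇ω₍₀₎)_{13}` (generated by exact rational arithmetic, checked below by Lean). [cite: Hintz2026, Lemma 6.10] -/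
def dNMu13 (M a rm : ℝ) : List (ℝ × ℕ × ℕ) :=
  [((-4 : ℝ) * a, 7, 1),
      ((-2 : ℝ) * a * M + (2 : ℝ) * a * rm, 6, 1),
      ((-8 : ℝ) * a ^ 3 + (-4 : ℝ) * a * M ^ 2 + (2 : ℝ) * a * M * rm, 5, 1),
      ((4 : ℝ) * a ^ 3 * M + (-4 : ℝ) * a ^ 3 * rm, 4, 3),
      ((-4 : ℝ) * a ^ 3 * M + (6 : ℝ) * a ^ 3 * rm, 4, 1),
      ((4 : ℝ) * a ^ 5, 3, 5),
      ((-8 : ℝ) * a ^ 5 + (16 : ℝ) * a ^ 3 * M ^ 2 + (-8 : ℝ) * a ^ 3 * M * rm, 3, 3),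
      ((-16 : ℝ) * a ^ 3 * M ^ 2 + (8 : ℝ) * a ^ 3 * M * rm, 3, 1),
      ((6 : ℝ) * a ^ 5 * M + (-6 : ℝ) * a ^ 5 * rm, 2, 5),
      ((-12 : ℝ) * a ^ 5 * M + (4 : ℝ) * a ^ 5 * rm, 2, 3),
      ((8 : ℝ) * a ^ 5 * M, 2, 1),
      ((-4 : ℝ) * a ^ 5 * M ^ 2 + (2 : ℝ) * a ^ 5 * M * rm, 1, 5),
      ((8 : ℝ) * a ^ 5 * M ^ 2 + (-4 : ℝ) * a ^ 5 * M * rm, 1, 3),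
      ((4 : ℝ) * a ^ 7 * M + (-2 : ℝ) * a ^ 7 * rm, 0, 5),
      ((-4 : ℝ) * a ^ 7 * M, 0, 3)]
/-- numerator list of `∂_r (∇ω₍₀₎)_{20}` (generated by exact rational arithmetic, checked below by Lean). [cite: Hintz2026, Lemma 6.10] -/
def dNR20 (a : ℝ) : List (ℝ × ℕ × ℕ) :=
  [((6 : ℝ) * a ^ 2, 2, 1),
      ((-2 : ℝ) * a ^ 4, 0, 3)]
/-- numerator list of `∂_μ (∇ω₍₀₎)_{20}` (generated by exact rational arithmetic, checked below by Lean). [cite: Hintz2026, Lemma 6.10] -/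
def dNMu20 (a : ℝ) : List (ℝ × ℕ × ℕ) :=
  [((-2 : ℝ) * a ^ 2, 3, 0),
      ((6 : ℝ) * a ^ 4, 1, 2)]
/-- numerator list of `∂_r (∇ω₍₀₎)_{21}` (generated by exact rational arithmetic, checked below by Lean). [cite: Hintz2026, Lemma 6.10] -/
def dNR21 (a rm : ℝ) : List (ℝ × ℕ × ℕ) :=
  [((3 : ℝ) * a ^ 2, 4, 1),
      ((-10 : ℝ) * a ^ 2 * rm, 3, 1),
      ((-6 : ℝ) * a ^ 4, 2, 3),
      ((6 : ℝ) * a ^ 2 * rm ^ 2, 2, 1),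
      ((6 : ℝ) * a ^ 4 * rm, 1, 3),
      ((-1 : ℝ) * a ^ 6, 0, 5),
      ((-2 : ℝ) * a ^ 4 * rm ^ 2, 0, 3)]
/-- numerator list of `∂_μ (∇ω₍₀₎)_{21}` (generated by exact rational arithmetic, checked below by Lean). [cite: Hintz2026, Lemma 6.10] -/
def dNMu21 (a rm : ℝ) : List (ℝ × ℕ × ℕ) :=
  [((-1 : ℝ) * a ^ 2, 4, 0),
      ((2 : ℝ) * a ^ 2 * rm, 3, 0),
      ((6 : ℝ) * a ^ 4, 2, 2),
      ((-6 : ℝ) * a ^ 4 * rm, 1, 2),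
      ((-1 : ℝ) * a ^ 6, 0, 4)]
/-- numerator list of `∂_r (∇ω₍₀₎)_{22}` (generated by exact rational arithmetic, checked below by Lean). [cite: Hintz2026, Lemma 6.10] -/
def dNR22 (M a rm : ℝ) : List (ℝ × ℕ × ℕ) :=
  [((-2 : ℝ) * M + (1 : ℝ) * rm, 4, 0),
      ((2 : ℝ) * a ^ 2, 3, 0),
      ((2 : ℝ) * a ^ 2 * M + (-1 : ℝ) * a ^ 2 * rm, 2, 2),
      ((-1 : ℝ) * a ^ 2 * rm, 2, 0),
      ((-4 : ℝ) * a ^ 2 * M * rm + (2 : ℝ) * a ^ 2 * rm ^ 2, 1, 2),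
      ((1 : ℝ) * a ^ 4 * rm, 0, 2)]
/-- numerator list of `∂_μ (∇ω₍₀₎)_{22}` (generated by exact rational arithmetic, checked below by Lean). [cite: Hintz2026, Lemma 6.10] -/
def dNMu22 (M a rm : ℝ) : List (ℝ × ℕ × ℕ) :=
  [((4 : ℝ) * M + (-2 : ℝ) * rm, 4, 1),
      ((-2 : ℝ) * a ^ 2, 3, 1),
      ((8 : ℝ) * a ^ 2 * M + (-4 : ℝ) * a ^ 2 * rm, 2, 3),
      ((-4 : ℝ) * a ^ 2 * M + (2 : ℝ) * a ^ 2 * rm, 2, 1),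
      ((-4 : ℝ) * a ^ 4, 1, 3),
      ((2 : ℝ) * a ^ 4, 1, 1)]
/-- numerator list of `∂_r (∇ω₍₀₎)_{23}` (generated by exact rational arithmetic, checked below by Lean). [cite: Hintz2026, Lemma 6.10] -/
def dNR23 (a : ℝ) : List (ℝ × ℕ × ℕ) :=
  [((-1 : ℝ) * a, 4, 1),
      ((6 : ℝ) * a ^ 3, 2, 3),
      ((-6 : ℝ) * a ^ 3, 2, 1),
      ((-1 : ℝ) * a ^ 5, 0, 5),
      ((2 : ℝ) * a ^ 5, 0, 3)]
/-- numerator list of `∂_μ (∇ω₍₀₎)_{23}` (generated by exact rational arithmetic, checked below by Lean). [cite: Hintz2026, Lemma 6.10] -/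
def dNMu23 (a : ℝ) : List (ℝ × ℕ × ℕ) :=
  [((1 : ℝ) * a, 5, 0),
      ((-6 : ℝ) * a ^ 3, 3, 2),
      ((2 : ℝ) * a ^ 3, 3, 0),
      ((1 : ℝ) * a ^ 5, 1, 4),
      ((-6 : ℝ) * a ^ 5, 1, 2)]
/-- numerator list of `∂_r (∇ω₍₀₎)_{30}` (generated by exact rational arithmetic, checked below by Lean). [cite: Hintz2026, Lemma 6.10] -/
def dNR30 (M a rm : ℝ) : List (ℝ × ℕ × ℕ) :=
  [((8 : ℝ) * a * M ^ 2 + (-4 : ℝ) * a * M * rm, 5, 2),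
      ((-8 : ℝ) * a * M ^ 2 + (4 : ℝ) * a * M * rm, 5, 0),
      ((-5 : ℝ) * a ^ 3 * M + (-6 : ℝ) * a * M ^ 2 * rm + (3 : ℝ) * a * M * rm ^ 2, 4, 2),
      ((5 : ℝ) * a ^ 3 * M + (6 : ℝ) * a * M ^ 2 * rm + (-3 : ℝ) * a * M * rm ^ 2, 4, 0),
      ((-16 : ℝ) * a ^ 3 * M ^ 2 + (8 : ℝ) * a ^ 3 * M * rm, 3, 4),
      ((16 : ℝ) * a ^ 3 * M ^ 2 + (-4 : ℝ) * a ^ 3 * M * rm, 3, 2),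
      ((-4 : ℝ) * a ^ 3 * M * rm, 3, 0),
      ((8 : ℝ) * a ^ 5 * M + (16 : ℝ) * a ^ 3 * M ^ 2 * rm + (-8 : ℝ) * a ^ 3 * M * rm ^ 2, 2, 4),
      ((-8 : ℝ) * a ^ 5 * M + (-16 : ℝ) * a ^ 3 * M ^ 2 * rm + (8 : ℝ) * a ^ 3 * M * rm ^ 2, 2, 2),
      ((-8 : ℝ) * a ^ 5 * M * rm, 1, 4),
      ((8 : ℝ) * a ^ 5 * M * rm, 1, 2),
      ((1 : ℝ) * a ^ 7 * M + (-2 : ℝ) * a ^ 5 * M ^ 2 * rm + (1 : ℝ) * a ^ 5 * M * rm ^ 2, 0, 6),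
      ((-1 : ℝ) * a ^ 7 * M + (2 : ℝ) * a ^ 5 * M ^ 2 * rm + (-1 : ℝ) * a ^ 5 * M * rm ^ 2, 0, 4)]
/-- numerator list of `∂_μ (∇ω₍₀₎)_{30}` (generated by exact rational arithmetic, checked below by Lean). [cite: Hintz2026, Lemma 6.10] -/
def dNMu30 (M a rm : ℝ) : List (ℝ × ℕ × ℕ) :=
  [((-4 : ℝ) * a * M ^ 2 + (2 : ℝ) * a * M * rm, 5, 1),
      ((2 : ℝ) * a ^ 3 * M, 4, 1),
      ((16 : ℝ) * a ^ 3 * M ^ 2 + (-8 : ℝ) * a ^ 3 * M * rm, 3, 3),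
      ((-16 : ℝ) * a ^ 3 * M ^ 2 + (8 : ℝ) * a ^ 3 * M * rm, 3, 1),
      ((-8 : ℝ) * a ^ 5 * M, 2, 3),
      ((8 : ℝ) * a ^ 5 * M, 2, 1),
      ((-4 : ℝ) * a ^ 5 * M ^ 2 + (2 : ℝ) * a ^ 5 * M * rm, 1, 5),
      ((8 : ℝ) * a ^ 5 * M ^ 2 + (-4 : ℝ) * a ^ 5 * M * rm, 1, 3),
      ((2 : ℝ) * a ^ 7 * M, 0, 5),
      ((-4 : ℝ) * a ^ 7 * M, 0, 3)]
/-- numerator list of `∂_r (∇ω₍₀₎)_{31}` (generated by exact rational arithmetic, checked below by Lean). [cite: Hintz2026, Lemma 6.10] -/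
def dNR31 (M a rm : ℝ) : List (ℝ × ℕ × ℕ) :=
  [((2 : ℝ) * a, 7, 2),
      ((-2 : ℝ) * a, 7, 0),
      ((3 : ℝ) * a * M + (-1 : ℝ) * a * rm, 6, 2),
      ((-3 : ℝ) * a * M + (1 : ℝ) * a * rm, 6, 0),
      ((4 : ℝ) * a ^ 3, 5, 4),
      ((-4 : ℝ) * a ^ 3 + (8 : ℝ) * a * M ^ 2 + (-6 : ℝ) * a * M * rm, 5, 2),
      ((-8 : ℝ) * a * M ^ 2 + (6 : ℝ) * a * M * rm, 5, 0),
      ((-3 : ℝ) * a ^ 3 * M + (-1 : ℝ) * a ^ 3 * rm, 4, 4),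
      ((-2 : ℝ) * a ^ 3 * M + (1 : ℝ) * a ^ 3 * rm + (-6 : ℝ) * a * M ^ 2 * rm + (3 : ℝ) * a * M * rm ^ 2, 4, 2),
      ((5 : ℝ) * a ^ 3 * M + (6 : ℝ) * a * M ^ 2 * rm + (-3 : ℝ) * a * M * rm ^ 2, 4, 0),
      ((2 : ℝ) * a ^ 5, 3, 6),
      ((-2 : ℝ) * a ^ 5 + (-16 : ℝ) * a ^ 3 * M ^ 2 + (12 : ℝ) * a ^ 3 * M * rm, 3, 4),
      ((16 : ℝ) * a ^ 3 * M ^ 2 + (-8 : ℝ) * a ^ 3 * M * rm, 3, 2),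
      ((-4 : ℝ) * a ^ 3 * M * rm, 3, 0),
      ((-7 : ℝ) * a ^ 5 * M + (1 : ℝ) * a ^ 5 * rm, 2, 6),
      ((15 : ℝ) * a ^ 5 * M + (-1 : ℝ) * a ^ 5 * rm + (16 : ℝ) * a ^ 3 * M ^ 2 * rm + (-8 : ℝ) * a ^ 3 * M * rm ^ 2, 2, 4),
      ((-8 : ℝ) * a ^ 5 * M + (-16 : ℝ) * a ^ 3 * M ^ 2 * rm + (8 : ℝ) * a ^ 3 * M * rm ^ 2, 2, 2),
      ((6 : ℝ) * a ^ 5 * M * rm, 1, 6),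
      ((-14 : ℝ) * a ^ 5 * M * rm, 1, 4),
      ((8 : ℝ) * a ^ 5 * M * rm, 1, 2),
      ((-1 : ℝ) * a ^ 7 * M + (1 : ℝ) * a ^ 7 * rm, 0, 8),
      ((2 : ℝ) * a ^ 7 * M + (-1 : ℝ) * a ^ 7 * rm + (-2 : ℝ) * a ^ 5 * M ^ 2 * rm + (1 : ℝ) * a ^ 5 * M * rm ^ 2, 0, 6),
      ((-1 : ℝ) * a ^ 7 * M + (2 : ℝ) * a ^ 5 * M ^ 2 * rm + (-1 : ℝ) * a ^ 5 * M * rm ^ 2, 0, 4)]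
/-- numerator list of `∂_μ (∇ω₍₀₎)_{31}` (generated by exact rational arithmetic, checked below by Lean). [cite: Hintz2026, Lemma 6.10] -/
def dNMu31 (M a rm : ℝ) : List (ℝ × ℕ × ℕ) :=
  [((-2 : ℝ) * a, 7, 1),
      ((-2 : ℝ) * a * M, 6, 1),
      ((-4 : ℝ) * a ^ 3, 5, 3),
      ((-2 : ℝ) * a ^ 3 + (-4 : ℝ) * a * M ^ 2 + (2 : ℝ) * a * M * rm, 5, 1),
      ((4 : ℝ) * a ^ 3 * M, 4, 3),
      ((-4 : ℝ) * a ^ 3 * M, 4, 1),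
      ((-2 : ℝ) * a ^ 5, 3, 5),
      ((-4 : ℝ) * a ^ 5 + (16 : ℝ) * a ^ 3 * M ^ 2 + (-8 : ℝ) * a ^ 3 * M * rm, 3, 3),
      ((-16 : ℝ) * a ^ 3 * M ^ 2 + (8 : ℝ) * a ^ 3 * M * rm, 3, 1),
      ((6 : ℝ) * a ^ 5 * M, 2, 5),
      ((-12 : ℝ) * a ^ 5 * M, 2, 3),
      ((8 : ℝ) * a ^ 5 * M, 2, 1),
      ((-2 : ℝ) * a ^ 7 + (-4 : ℝ) * a ^ 5 * M ^ 2 + (2 : ℝ) * a ^ 5 * M * rm, 1, 5),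
      ((8 : ℝ) * a ^ 5 * M ^ 2 + (-4 : ℝ) * a ^ 5 * M * rm, 1, 3),
      ((4 : ℝ) * a ^ 7 * M, 0, 5),
      ((-4 : ℝ) * a ^ 7 * M, 0, 3)]
/-- numerator list of `∂_r (∇ω₍₀₎)_{32}` (generated by exact rational arithmetic, checked below by Lean). [cite: Hintz2026, Lemma 6.10] -/
def dNR32 (a : ℝ) : List (ℝ × ℕ × ℕ) :=
  [((1 : ℝ) * a, 2, 1),
      ((-1 : ℝ) * a ^ 3, 0, 3)]
/-- numerator list of `∂_μ (∇ω₍₀₎)_{32}` (generated by exact rational arithmetic, checked below by Lean). [cite: Hintz2026, Lemma 6.10] -/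
def dNMu32 (a : ℝ) : List (ℝ × ℕ × ℕ) :=
  [((-1 : ℝ) * a, 3, 0),
      ((1 : ℝ) * a ^ 3, 1, 2)]
/-- numerator list of `∂_r (∇ω₍₀₎)_{33}` (generated by exact rational arithmetic, checked below by Lean). [cite: Hintz2026, Lemma 6.10] -/
def dNR33 (M a rm : ℝ) : List (ℝ × ℕ × ℕ) :=
  [((2 : ℝ) * M + (-1 : ℝ) * rm, 8, 2),
      ((-2 : ℝ) * M + (1 : ℝ) * rm, 8, 0),
      ((-2 : ℝ) * a ^ 2, 7, 2),
      ((2 : ℝ) * a ^ 2, 7, 0),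
      ((2 : ℝ) * a ^ 2 * M + (-1 : ℝ) * a ^ 2 * rm, 6, 4),
      ((-2 : ℝ) * a ^ 2 * M + (2 : ℝ) * a ^ 2 * rm, 6, 2),
      ((-1 : ℝ) * a ^ 2 * rm, 6, 0),
      ((-4 : ℝ) * a ^ 4 + (8 : ℝ) * a ^ 2 * M ^ 2 + (-2 : ℝ) * a ^ 2 * rm ^ 2, 5, 4),
      ((4 : ℝ) * a ^ 4 + (-16 : ℝ) * a ^ 2 * M ^ 2 + (4 : ℝ) * a ^ 2 * M * rm + (2 : ℝ) * a ^ 2 * rm ^ 2, 5, 2),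
      ((8 : ℝ) * a ^ 2 * M ^ 2 + (-4 : ℝ) * a ^ 2 * M * rm, 5, 0),
      ((-2 : ℝ) * a ^ 4 * M + (1 : ℝ) * a ^ 4 * rm, 4, 6),
      ((-3 : ℝ) * a ^ 4 * M + (-6 : ℝ) * a ^ 2 * M ^ 2 * rm + (3 : ℝ) * a ^ 2 * M * rm ^ 2, 4, 4),
      ((10 : ℝ) * a ^ 4 * M + (-1 : ℝ) * a ^ 4 * rm + (12 : ℝ) * a ^ 2 * M ^ 2 * rm + (-6 : ℝ) * a ^ 2 * M * rm ^ 2, 4, 2),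
      ((-5 : ℝ) * a ^ 4 * M + (-6 : ℝ) * a ^ 2 * M ^ 2 * rm + (3 : ℝ) * a ^ 2 * M * rm ^ 2, 4, 0),
      ((-2 : ℝ) * a ^ 6 + (-16 : ℝ) * a ^ 4 * M ^ 2 + (16 : ℝ) * a ^ 4 * M * rm + (-4 : ℝ) * a ^ 4 * rm ^ 2, 3, 6),
      ((2 : ℝ) * a ^ 6 + (32 : ℝ) * a ^ 4 * M ^ 2 + (-20 : ℝ) * a ^ 4 * M * rm + (4 : ℝ) * a ^ 4 * rm ^ 2, 3, 4),
      ((-16 : ℝ) * a ^ 4 * M ^ 2, 3, 2),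
      ((4 : ℝ) * a ^ 4 * M * rm, 3, 0),
      ((-2 : ℝ) * a ^ 6 * M + (1 : ℝ) * a ^ 6 * rm, 2, 8),
      ((10 : ℝ) * a ^ 6 * M + (-2 : ℝ) * a ^ 6 * rm + (16 : ℝ) * a ^ 4 * M ^ 2 * rm + (-8 : ℝ) * a ^ 4 * M * rm ^ 2, 2, 6),
      ((-16 : ℝ) * a ^ 6 * M + (1 : ℝ) * a ^ 6 * rm + (-32 : ℝ) * a ^ 4 * M ^ 2 * rm + (16 : ℝ) * a ^ 4 * M * rm ^ 2, 2, 4),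
      ((8 : ℝ) * a ^ 6 * M + (16 : ℝ) * a ^ 4 * M ^ 2 * rm + (-8 : ℝ) * a ^ 4 * M * rm ^ 2, 2, 2),
      ((4 : ℝ) * a ^ 6 * M * rm + (-2 : ℝ) * a ^ 6 * rm ^ 2, 1, 8),
      ((-12 : ℝ) * a ^ 6 * M * rm + (2 : ℝ) * a ^ 6 * rm ^ 2, 1, 6),
      ((16 : ℝ) * a ^ 6 * M * rm, 1, 4),
      ((-8 : ℝ) * a ^ 6 * M * rm, 1, 2),
      ((1 : ℝ) * a ^ 8 * M + (-1 : ℝ) * a ^ 8 * rm + (-2 : ℝ) * a ^ 6 * M ^ 2 * rm + (1 : ℝ) * a ^ 6 * M * rm ^ 2, 0, 8),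
      ((-2 : ℝ) * a ^ 8 * M + (1 : ℝ) * a ^ 8 * rm + (4 : ℝ) * a ^ 6 * M ^ 2 * rm + (-2 : ℝ) * a ^ 6 * M * rm ^ 2, 0, 6),
      ((1 : ℝ) * a ^ 8 * M + (-2 : ℝ) * a ^ 6 * M ^ 2 * rm + (1 : ℝ) * a ^ 6 * M * rm ^ 2, 0, 4)]
/-- numerator list of `∂_μ (∇ω₍₀₎)_{33}` (generated by exact rational arithmetic, checked below by Lean). [cite: Hintz2026, Lemma 6.10] -/
def dNMu33 (M a rm : ℝ) : List (ℝ × ℕ × ℕ) :=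
  [((-4 : ℝ) * M + (2 : ℝ) * rm, 8, 1),
      ((2 : ℝ) * a ^ 2, 7, 1),
      ((-8 : ℝ) * a ^ 2 * M + (4 : ℝ) * a ^ 2 * rm, 6, 3),
      ((-4 : ℝ) * a ^ 2 * M + (2 : ℝ) * a ^ 2 * rm, 6, 1),
      ((4 : ℝ) * a ^ 4 + (-8 : ℝ) * a ^ 2 * M ^ 2 + (4 : ℝ) * a ^ 2 * M * rm, 5, 3),
      ((2 : ℝ) * a ^ 4 + (8 : ℝ) * a ^ 2 * M ^ 2 + (-4 : ℝ) * a ^ 2 * M * rm, 5, 1),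
      ((-4 : ℝ) * a ^ 4 * M + (2 : ℝ) * a ^ 4 * rm, 4, 5),
      ((-4 : ℝ) * a ^ 4 * M + (4 : ℝ) * a ^ 4 * rm, 4, 3),
      ((-4 : ℝ) * a ^ 4 * M, 4, 1),
      ((2 : ℝ) * a ^ 6 + (16 : ℝ) * a ^ 4 * M ^ 2 + (-8 : ℝ) * a ^ 4 * M * rm, 3, 5),
      ((4 : ℝ) * a ^ 6 + (-32 : ℝ) * a ^ 4 * M ^ 2 + (16 : ℝ) * a ^ 4 * M * rm, 3, 3),
      ((16 : ℝ) * a ^ 4 * M ^ 2 + (-8 : ℝ) * a ^ 4 * M * rm, 3, 1),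
      ((-12 : ℝ) * a ^ 6 * M + (2 : ℝ) * a ^ 6 * rm, 2, 5),
      ((16 : ℝ) * a ^ 6 * M, 2, 3),
      ((-8 : ℝ) * a ^ 6 * M, 2, 1),
      ((2 : ℝ) * a ^ 8 + (8 : ℝ) * a ^ 6 * M ^ 2 + (-4 : ℝ) * a ^ 6 * M * rm, 1, 5),
      ((-8 : ℝ) * a ^ 6 * M ^ 2 + (4 : ℝ) * a ^ 6 * M * rm, 1, 3),
      ((-4 : ℝ) * a ^ 8 * M, 0, 5),
      ((4 : ℝ) * a ^ 8 * M, 0, 3)]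
/-- **`(∇ω₍₀₎)_{ki}` in closed form** (`k` = derivative slot): rational functions of `r, μ` with
denominators `Σ³(r − r₋)`, … . [cite: Hintz2026, Lemma 6.10] -/
def covOmega (M a rm : ℝ) (u : E4) : Fin 4 → Fin 4 → ℝ :=
  !![poly2 (cN00 M a rm) u / (sigma a u ^ (3 : ℕ) * sinSq u ^ (0 : ℕ) * (u 1 - rm) ^ (1 : ℕ)), poly2 (cN01 M a rm) u / (sigma a u ^ (3 : ℕ) * sinSq u ^ (0 : ℕ) * (u 1 - rm) ^ (1 : ℕ)), 0, poly2 (cN03 M a rm) u / (sigma a u ^ (3 : ℕ) * sinSq u ^ (0 : ℕ) * (u 1 - rm) ^ (1 : ℕ));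
     poly2 (cN10 M a rm) u / (sigma a u ^ (3 : ℕ) * sinSq u ^ (0 : ℕ) * (u 1 - rm) ^ (1 : ℕ)), poly2 (cN11 M a rm) u / (sigma a u ^ (3 : ℕ) * sinSq u ^ (0 : ℕ) * (u 1 - rm) ^ (2 : ℕ)), poly2 (cN12 a) u / (sigma a u ^ (1 : ℕ) * sinSq u ^ (0 : ℕ) * (u 1 - rm) ^ (1 : ℕ)), poly2 (cN13 M a rm) u / (sigma a u ^ (3 : ℕ) * sinSq u ^ (0 : ℕ) * (u 1 - rm) ^ (1 : ℕ));
     poly2 (cN20 a) u / (sigma a u ^ (2 : ℕ) * sinSq u ^ (0 : ℕ) * (u 1 - rm) ^ (0 : ℕ)), poly2 (cN21 a rm) u / (sigma a u ^ (2 : ℕ) * sinSq u ^ (0 : ℕ) * (u 1 - rm) ^ (1 : ℕ)), poly2 (cN22 M a rm) u / (sigma a u ^ (1 : ℕ) * sinSq u ^ (1 : ℕ) * (u 1 - rm) ^ (1 : ℕ)), poly2 (cN23 a) u / (sigma a u ^ (2 : ℕ) * sinSq u ^ (0 : ℕ) * (u 1 - rm) ^ (0 : ℕ));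
     poly2 (cN30 M a rm) u / (sigma a u ^ (3 : ℕ) * sinSq u ^ (0 : ℕ) * (u 1 - rm) ^ (1 : ℕ)), poly2 (cN31 M a rm) u / (sigma a u ^ (3 : ℕ) * sinSq u ^ (0 : ℕ) * (u 1 - rm) ^ (1 : ℕ)), poly2 (cN32 a) u / (sigma a u ^ (1 : ℕ) * sinSq u ^ (0 : ℕ) * (u 1 - rm) ^ (0 : ℕ)), poly2 (cN33 M a rm) u / (sigma a u ^ (3 : ℕ) * sinSq u ^ (0 : ℕ) * (u 1 - rm) ^ (1 : ℕ))]
/-- `∂_r (∇ω₍₀₎)_{ki}` in closed form. [cite: Hintz2026, Lemma 6.10] -/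
def covOmegaR (M a rm : ℝ) (u : E4) : Fin 4 → Fin 4 → ℝ :=
  !![poly2 (dNR00 M a rm) u / (sigma a u ^ (4 : ℕ) * sinSq u ^ (0 : ℕ) * (u 1 - rm) ^ (2 : ℕ)), poly2 (dNR01 M a rm) u / (sigma a u ^ (4 : ℕ) * sinSq u ^ (0 : ℕ) * (u 1 - rm) ^ (2 : ℕ)), 0, poly2 (dNR03 M a rm) u / (sigma a u ^ (4 : ℕ) * sinSq u ^ (0 : ℕ) * (u 1 - rm) ^ (2 : ℕ));
     poly2 (dNR10 M a rm) u / (sigma a u ^ (4 : ℕ) * sinSq u ^ (0 : ℕ) * (u 1 - rm) ^ (2 : ℕ)), poly2 (dNR11 M a rm) u / (sigma a u ^ (4 : ℕ) * sinSq u ^ (0 : ℕ) * (u 1 - rm) ^ (3 : ℕ)), poly2 (dNR12 a rm) u / (sigma a u ^ (2 : ℕ) * sinSq u ^ (0 : ℕ) * (u 1 - rm) ^ (2 : ℕ)), poly2 (dNR13 M a rm) u / (sigma a u ^ (4 : ℕ) * sinSq u ^ (0 : ℕ) * (u 1 - rm) ^ (2 : ℕ));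
     poly2 (dNR20 a) u / (sigma a u ^ (3 : ℕ) * sinSq u ^ (0 : ℕ) * (u 1 - rm) ^ (0 : ℕ)), poly2 (dNR21 a rm) u / (sigma a u ^ (3 : ℕ) * sinSq u ^ (0 : ℕ) * (u 1 - rm) ^ (2 : ℕ)), poly2 (dNR22 M a rm) u / (sigma a u ^ (2 : ℕ) * sinSq u ^ (1 : ℕ) * (u 1 - rm) ^ (2 : ℕ)), poly2 (dNR23 a) u / (sigma a u ^ (3 : ℕ) * sinSq u ^ (0 : ℕ) * (u 1 - rm) ^ (0 : ℕ));
     poly2 (dNR30 M a rm) u / (sigma a u ^ (4 : ℕ) * sinSq u ^ (0 : ℕ) * (u 1 - rm) ^ (2 : ℕ)), poly2 (dNR31 M a rm) u / (sigma a u ^ (4 : ℕ) * sinSq u ^ (0 : ℕ) * (u 1 - rm) ^ (2 : ℕ)), poly2 (dNR32 a) u / (sigma a u ^ (2 : ℕ) * sinSq u ^ (0 : ℕ) * (u 1 - rm) ^ (0 : ℕ)), poly2 (dNR33 M a rm) u / (sigma a u ^ (4 : ℕ) * sinSq u ^ (0 : ℕ) * (u 1 - rm) ^ (2 : ℕ)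)]

/-- `∂_μ (∇ω₍₀₎)_{ki}` in closed form. [cite: Hintz2026, Lemma 6.10] -/
def covOmegaM (M a rm : ℝ) (u : E4) : Fin 4 → Fin 4 → ℝ :=
  !![poly2 (dNMu00 M a rm) u / (sigma a u ^ (4 : ℕ) * sinSq u ^ (0 : ℕ) * (u 1 - rm) ^ (1 : ℕ)), poly2 (dNMu01 M a rm) u / (sigma a u ^ (4 : ℕ) * sinSq u ^ (0 : ℕ) * (u 1 - rm) ^ (1 : ℕ)), 0, poly2 (dNMu03 M a rm) u / (sigma a u ^ (4 : ℕ) * sinSq u ^ (0 : ℕ) * (u 1 - rm) ^ (1 : ℕ));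
     poly2 (dNMu10 M a rm) u / (sigma a u ^ (4 : ℕ) * sinSq u ^ (0 : ℕ) * (u 1 - rm) ^ (1 : ℕ)), poly2 (dNMu11 M a rm) u / (sigma a u ^ (4 : ℕ) * sinSq u ^ (0 : ℕ) * (u 1 - rm) ^ (1 : ℕ)), poly2 (dNMu12 a) u / (sigma a u ^ (2 : ℕ) * sinSq u ^ (0 : ℕ) * (u 1 - rm) ^ (1 : ℕ)), poly2 (dNMu13 M a rm) u / (sigma a u ^ (4 : ℕ) * sinSq u ^ (0 : ℕ) * (u 1 - rm) ^ (1 : ℕ));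
     poly2 (dNMu20 a) u / (sigma a u ^ (3 : ℕ) * sinSq u ^ (0 : ℕ) * (u 1 - rm) ^ (0 : ℕ)), poly2 (dNMu21 a rm) u / (sigma a u ^ (3 : ℕ) * sinSq u ^ (0 : ℕ) * (u 1 - rm) ^ (1 : ℕ)), poly2 (dNMu22 M a rm) u / (sigma a u ^ (2 : ℕ) * sinSq u ^ (2 : ℕ) * (u 1 - rm) ^ (1 : ℕ)), poly2 (dNMu23 a) u / (sigma a u ^ (3 : ℕ) * sinSq u ^ (0 : ℕ) * (u 1 - rm) ^ (0 : ℕ));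
     poly2 (dNMu30 M a rm) u / (sigma a u ^ (4 : ℕ) * sinSq u ^ (0 : ℕ) * (u 1 - rm) ^ (1 : ℕ)), poly2 (dNMu31 M a rm) u / (sigma a u ^ (4 : ℕ) * sinSq u ^ (0 : ℕ) * (u 1 - rm) ^ (1 : ℕ)), poly2 (dNMu32 a) u / (sigma a u ^ (2 : ℕ) * sinSq u ^ (0 : ℕ) * (u 1 - rm) ^ (0 : ℕ)), poly2 (dNMu33 M a rm) u / (sigma a u ^ (4 : ℕ) * sinSq u ^ (0 : ℕ) * (u 1 - rm) ^ (1 : ℕ))]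

/-! ### `∇ω₍₀₎` -/

/-- **The covariant derivative of `ω₍₀₎`**: `(∇ω₍₀₎)_{ki} = ∂_k ω_i − Γ^m_{ki} ω_m` equals the closed
form `covOmega` at every point with `Σ ≠ 0`, `μ² ≠ 1`, `r ≠ r₋` (O'Neill 1983, Ch. 2, Prop. 2.13, with
the tree's Christoffel symbols). [cite: Hintz2026, Lemma 6.10] -/
theorem tcov_omega0 (hu : u ∈ regularSet a) (hr : u 1 ≠ rm) (k i : Fin 4) :
    tcov (bilin M a) bF (omega0 a rm) u (ocons k (uidx i)) = covOmega M a rm u k i := by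
  have hS := hu.1
  have hP := hu.2
  have hr' : u 1 - rm ≠ 0 := sub_ne_zero.mpr hr
  rw [tcov_apply_uidx, bF_apply, fderiv_omega0 hS hr' i, Fin.sum_univ_four]
  simp only [chrCoef_bF]
  fin_cases k <;> fin_cases i <;> simp only [Fin.zero_eta, Fin.mk_one, Fin.reduceFinMk, Fin.isValue,
    bv_apply, Fin.reduceEq, if_true, if_false, Matrix.of_apply, Matrix.cons_val', Matrix.cons_val_zero, Matrix.cons_val_one, Matrix.cons_val, Matrix.empty_val', Matrix.cons_val_fin_one, PiLp.toLp_apply, chrAt_bv_00 M a hu, chrAt_bv_01 M a hu, chrAt_bv_02 M a hu, chrAt_bv_03 M a hu, chrAt_bv_11 M a hu, chrAt_bv_12 M a hu, chrAt_bv_13 M a hu, chrAt_bv_22 M a hu, chrAt_bv_23 M a hu, chrAt_bv_33 M a hu, chrAt_bv_swap M a hu 1 0, chrAt_bv_swap M a hu 2 0, chrAt_bv_swap M a hu 3 0, chrAt_bv_swap M a hu 2 1, chrAt_bv_swap M a hu 3 1, chrAt_bv_swap M a hu 3 2,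
    omega0_uidx_0, omega0_uidx_1, omega0_uidx_2, omega0_uidx_3, omR, omM, covOmega, cN00, cN01, cN03, cN10, cN11, cN12, cN13, cN20, cN21, cN22, cN23, cN30, cN31, cN32, cN33,
    poly2_cons, poly2_nil, pow_zero, pow_one, mul_one, mul_zero, zero_mul, add_zero, zero_add, zero_sub,
    one_mul] <;> field_simp <;>
    simp only [sigma, sinSq] at hS hP ⊢ <;> ring

/-- **`ω₍₀₎` is divergence-free**: `g^{jk} (∇ω₍₀₎)_{jk} = 0` whenever `r₋` is a root of `Δ`
(for all `M`, `a`: no smallness of the spin). [cite: Hintz2026, Lemma 6.10] -/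
theorem div_omega0 (hu : u ∈ regularSet a) (hr : u 1 ≠ rm) (hrel : rm ^ 2 - 2 * M * rm + a ^ 2 = 0) :
    ∑ j, ∑ k, ginv (bilin M a) bF u j k * tcov (bilin M a) bF (omega0 a rm) u (ocons j (uidx k)) = 0 := by
  have hS := hu.1
  have hP := hu.2
  have hr' : u 1 - rm ≠ 0 := sub_ne_zero.mpr hr
  simp only [Fin.sum_univ_four, ginv_basisFun M a hu, tcov_omega0 hu hr]
  simp only [Fin.isValue, ginvMat, covOmega, Matrix.of_apply, Matrix.cons_val', Matrix.cons_val_zero, Matrix.cons_val_one, Matrix.cons_val, Matrix.empty_val', Matrix.cons_val_fin_one, cN00, cN01, cN03, cN10, cN11, cN12, cN13, cN20, cN21, cN22, cN23, cN30, cN31, cN32, cN33, poly2_cons, poly2_nil, pow_zero, pow_one, mul_one,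
    mul_zero, zero_mul, add_zero, zero_add, h00, scalarH]
  rcases eq_or_ne rm 0 with h0 | h0
  · subst h0
    have ha : a = 0 := by nlinarith [hrel, sq_nonneg a]
    subst ha
    field_simp
    simp only [sigma, sinSq] at hS hP ⊢
    ring
  · have hM : M = (rm ^ 2 + a ^ 2) / (2 * rm) := by
      field_simp
      linarith [hrel]
    subst hM
    field_simp
    simp only [sigma, sinSq] at hS hP ⊢
    ring

/-! ### First derivatives of the closed forms `(∇ω₍₀₎)_{ki}` -/

set_option maxHeartbeats 4000000 in
/-- **The gradients of the closed forms `(∇ω₍₀₎)_{ki}`** (quotient rule on the listed polynomials;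
each of the 2 × 16 closed forms is checked by `field_simp`/`ring`). [folklore] -/
theorem hasGrad_covOmega (hu : u ∈ regularSet a) (hr : u 1 ≠ rm) (k i : Fin 4) :
    HasGrad (fun y ↦ covOmega M a rm y k i) u (covOmegaR M a rm u k i) (covOmegaM M a rm u k i) := by
  have hS := hu.1
  have hP := hu.2
  have hr' : u 1 - rm ≠ 0 := sub_ne_zero.mpr hr
  fin_cases k <;> fin_cases i
  · -- (k,i) = (0,0)
    simp only [Fin.zero_eta, Fin.zero_eta, Fin.isValue, covOmega, covOmegaR, covOmegaM, Matrix.of_apply, Matrix.cons_val', Matrix.cons_val_zero, Matrix.empty_val', Matrix.cons_val_fin_one]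
    refine (hasGrad_poly2_div _ _ _ _ hS hP hr').congr ?_ ?_ <;>
      simp only [cN00, dNR00, dNMu00, poly2R, poly2M, List.map_cons, List.map_nil, poly2_cons, poly2_nil,
        Nat.cast_ofNat, Nat.cast_one, Nat.cast_zero, Nat.reduceSub, pow_zero, pow_one, mul_one, mul_zero,
        zero_mul, add_zero, zero_add] <;>
      field_simp <;> simp only [sigma, sinSq] at hS hP ⊢ <;> ring
  · -- (k,i) = (0,1)
    simp only [Fin.zero_eta, Fin.mk_one, Fin.isValue, covOmega, covOmegaR, covOmegaM, Matrix.of_apply, Matrix.cons_val', Matrix.cons_val_zero, Matrix.cons_val_one, Matrix.empty_val', Matrix.cons_val_fin_one]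
    refine (hasGrad_poly2_div _ _ _ _ hS hP hr').congr ?_ ?_ <;>
      simp only [cN01, dNR01, dNMu01, poly2R, poly2M, List.map_cons, List.map_nil, poly2_cons, poly2_nil,
        Nat.cast_ofNat, Nat.cast_one, Nat.cast_zero, Nat.reduceSub, pow_zero, pow_one, mul_one, mul_zero,
        zero_mul, add_zero, zero_add] <;>
      field_simp <;> simp only [sigma, sinSq] at hS hP ⊢ <;> ring
  · -- (k,i) = (0,2): identically zero
    simp only [Fin.zero_eta, Fin.reduceFinMk, Fin.isValue, covOmega, covOmegaR, covOmegaM, Matrix.of_apply, Matrix.cons_val', Matrix.cons_val_zero, Matrix.cons_val, Matrix.empty_val', Matrix.cons_val_fin_one]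
    exact HasGrad.const u 0
  · -- (k,i) = (0,3)
    simp only [Fin.zero_eta, Fin.reduceFinMk, Fin.isValue, covOmega, covOmegaR, covOmegaM, Matrix.of_apply, Matrix.cons_val', Matrix.cons_val_zero, Matrix.cons_val, Matrix.empty_val', Matrix.cons_val_fin_one]
    refine (hasGrad_poly2_div _ _ _ _ hS hP hr').congr ?_ ?_ <;>
      simp only [cN03, dNR03, dNMu03, poly2R, poly2M, List.map_cons, List.map_nil, poly2_cons, poly2_nil,
        Nat.cast_ofNat, Nat.cast_one, Nat.cast_zero, Nat.reduceSub, pow_zero, pow_one, mul_one, mul_zero,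
        zero_mul, add_zero, zero_add] <;>
      field_simp <;> simp only [sigma, sinSq] at hS hP ⊢ <;> ring
  · -- (k,i) = (1,0)
    simp only [Fin.mk_one, Fin.zero_eta, Fin.isValue, covOmega, covOmegaR, covOmegaM, Matrix.of_apply, Matrix.cons_val', Matrix.cons_val_zero, Matrix.cons_val_one, Matrix.empty_val', Matrix.cons_val_fin_one]
    refine (hasGrad_poly2_div _ _ _ _ hS hP hr').congr ?_ ?_ <;>
      simp only [cN10, dNR10, dNMu10, poly2R, poly2M, List.map_cons, List.map_nil, poly2_cons, poly2_nil,
        Nat.cast_ofNat, Nat.cast_one, Nat.cast_zero, Nat.reduceSub, pow_zero, pow_one, mul_one, mul_zero,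
        zero_mul, add_zero, zero_add] <;>
      field_simp <;> simp only [sigma, sinSq] at hS hP ⊢ <;> ring
  · -- (k,i) = (1,1)
    simp only [Fin.mk_one, Fin.mk_one, Fin.isValue, covOmega, covOmegaR, covOmegaM, Matrix.of_apply, Matrix.cons_val', Matrix.cons_val_zero, Matrix.cons_val_one, Matrix.empty_val', Matrix.cons_val_fin_one]
    refine (hasGrad_poly2_div _ _ _ _ hS hP hr').congr ?_ ?_ <;>
      simp only [cN11, dNR11, dNMu11, poly2R, poly2M, List.map_cons, List.map_nil, poly2_cons, poly2_nil,
        Nat.cast_ofNat, Nat.cast_one, Nat.cast_zero, Nat.reduceSub, pow_zero, pow_one, mul_one, mul_zero,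
        zero_mul, add_zero, zero_add] <;>
      field_simp <;> simp only [sigma, sinSq] at hS hP ⊢ <;> ring
  · -- (k,i) = (1,2)
    simp only [Fin.mk_one, Fin.reduceFinMk, Fin.isValue, covOmega, covOmegaR, covOmegaM, Matrix.of_apply, Matrix.cons_val', Matrix.cons_val_zero, Matrix.cons_val_one, Matrix.cons_val, Matrix.empty_val', Matrix.cons_val_fin_one]
    refine (hasGrad_poly2_div _ _ _ _ hS hP hr').congr ?_ ?_ <;>
      simp only [cN12, dNR12, dNMu12, poly2R, poly2M, List.map_cons, List.map_nil, poly2_cons, poly2_nil,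
        Nat.cast_one, Nat.cast_zero, Nat.reduceSub, pow_zero, pow_one, mul_one, mul_zero,
        zero_mul, add_zero] <;>
      field_simp <;> simp only [sigma, sinSq] at hS hP ⊢ <;> ring
  · -- (k,i) = (1,3)
    simp only [Fin.mk_one, Fin.reduceFinMk, Fin.isValue, covOmega, covOmegaR, covOmegaM, Matrix.of_apply, Matrix.cons_val', Matrix.cons_val_zero, Matrix.cons_val_one, Matrix.cons_val, Matrix.empty_val', Matrix.cons_val_fin_one]
    refine (hasGrad_poly2_div _ _ _ _ hS hP hr').congr ?_ ?_ <;>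
      simp only [cN13, dNR13, dNMu13, poly2R, poly2M, List.map_cons, List.map_nil, poly2_cons, poly2_nil,
        Nat.cast_ofNat, Nat.cast_one, Nat.cast_zero, Nat.reduceSub, pow_zero, pow_one, mul_one, mul_zero,
        zero_mul, add_zero, zero_add] <;>
      field_simp <;> simp only [sigma, sinSq] at hS hP ⊢ <;> ring
  · -- (k,i) = (2,0)
    simp only [Fin.reduceFinMk, Fin.zero_eta, Fin.isValue, covOmega, covOmegaR, covOmegaM, Matrix.of_apply, Matrix.cons_val', Matrix.cons_val_zero, Matrix.cons_val_one, Matrix.cons_val, Matrix.empty_val', Matrix.cons_val_fin_one]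
    refine (hasGrad_poly2_div _ _ _ _ hS hP hr').congr ?_ ?_ <;>
      simp only [cN20, dNR20, dNMu20, poly2R, poly2M, List.map_cons, List.map_nil, poly2_cons, poly2_nil,
        Nat.cast_ofNat, Nat.cast_one, Nat.cast_zero, Nat.reduceSub, pow_zero, pow_one, mul_one, mul_zero,
        zero_mul, add_zero] <;>
      field_simp <;> simp only [sigma, sinSq] at hS hP ⊢ <;> ring
  · -- (k,i) = (2,1)
    simp only [Fin.reduceFinMk, Fin.mk_one, Fin.isValue, covOmega, covOmegaR, covOmegaM, Matrix.of_apply, Matrix.cons_val', Matrix.cons_val_zero, Matrix.cons_val_one, Matrix.cons_val, Matrix.empty_val', Matrix.cons_val_fin_one]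
    refine (hasGrad_poly2_div _ _ _ _ hS hP hr').congr ?_ ?_ <;>
      simp only [cN21, dNR21, dNMu21, poly2R, poly2M, List.map_cons, List.map_nil, poly2_cons, poly2_nil,
        Nat.cast_ofNat, Nat.cast_one, Nat.cast_zero, Nat.reduceSub, pow_zero, pow_one, mul_one, mul_zero,
        zero_mul, add_zero] <;>
      field_simp <;> simp only [sigma, sinSq] at hS hP ⊢ <;> ring
  · -- (k,i) = (2,2)
    simp only [Fin.reduceFinMk, Fin.reduceFinMk, Fin.isValue, covOmega, covOmegaR, covOmegaM, Matrix.of_apply, Matrix.cons_val', Matrix.cons_val_zero, Matrix.cons_val_one, Matrix.cons_val, Matrix.empty_val', Matrix.cons_val_fin_one]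
    refine (hasGrad_poly2_div _ _ _ _ hS hP hr').congr ?_ ?_ <;>
      simp only [cN22, dNR22, dNMu22, poly2R, poly2M, List.map_cons, List.map_nil, poly2_cons, poly2_nil,
        Nat.cast_ofNat, Nat.cast_one, Nat.cast_zero, Nat.reduceSub, pow_zero, pow_one, mul_one, mul_zero,
        zero_mul, add_zero] <;>
      field_simp <;> simp only [sigma, sinSq] at hS hP ⊢ <;> ring
  · -- (k,i) = (2,3)
    simp only [Fin.reduceFinMk, Fin.reduceFinMk, Fin.isValue, covOmega, covOmegaR, covOmegaM, Matrix.of_apply, Matrix.cons_val', Matrix.cons_val_zero, Matrix.cons_val_one, Matrix.cons_val, Matrix.empty_val', Matrix.cons_val_fin_one]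
    refine (hasGrad_poly2_div _ _ _ _ hS hP hr').congr ?_ ?_ <;>
      simp only [cN23, dNR23, dNMu23, poly2R, poly2M, List.map_cons, List.map_nil, poly2_cons, poly2_nil,
        Nat.cast_ofNat, Nat.cast_one, Nat.cast_zero, Nat.reduceSub, pow_zero, pow_one, mul_one, mul_zero,
        zero_mul, add_zero] <;>
      field_simp <;> simp only [sigma, sinSq] at hS hP ⊢ <;> ring
  · -- (k,i) = (3,0)
    simp only [Fin.reduceFinMk, Fin.zero_eta, Fin.isValue, covOmega, covOmegaR, covOmegaM, Matrix.of_apply, Matrix.cons_val', Matrix.cons_val_zero, Matrix.cons_val_one, Matrix.cons_val, Matrix.empty_val', Matrix.cons_val_fin_one]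
    refine (hasGrad_poly2_div _ _ _ _ hS hP hr').congr ?_ ?_ <;>
      simp only [cN30, dNR30, dNMu30, poly2R, poly2M, List.map_cons, List.map_nil, poly2_cons, poly2_nil,
        Nat.cast_ofNat, Nat.cast_one, Nat.cast_zero, Nat.reduceSub, pow_zero, pow_one, mul_one, mul_zero,
        zero_mul, add_zero, zero_add] <;>
      field_simp <;> simp only [sigma, sinSq] at hS hP ⊢ <;> ring
  · -- (k,i) = (3,1)
    simp only [Fin.reduceFinMk, Fin.mk_one, Fin.isValue, covOmega, covOmegaR, covOmegaM, Matrix.of_apply, Matrix.cons_val', Matrix.cons_val_zero, Matrix.cons_val_one, Matrix.cons_val, Matrix.empty_val', Matrix.cons_val_fin_one]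
    refine (hasGrad_poly2_div _ _ _ _ hS hP hr').congr ?_ ?_ <;>
      simp only [cN31, dNR31, dNMu31, poly2R, poly2M, List.map_cons, List.map_nil, poly2_cons, poly2_nil,
        Nat.cast_ofNat, Nat.cast_one, Nat.cast_zero, Nat.reduceSub, pow_zero, pow_one, mul_one, mul_zero,
        zero_mul, add_zero, zero_add] <;>
      field_simp <;> simp only [sigma, sinSq] at hS hP ⊢ <;> ring
  · -- (k,i) = (3,2)
    simp only [Fin.reduceFinMk, Fin.reduceFinMk, Fin.isValue, covOmega, covOmegaR, covOmegaM, Matrix.of_apply, Matrix.cons_val', Matrix.cons_val_one, Matrix.cons_val, Matrix.empty_val', Matrix.cons_val_fin_one]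
    refine (hasGrad_poly2_div _ _ _ _ hS hP hr').congr ?_ ?_ <;>
      simp only [cN32, dNR32, dNMu32, poly2R, poly2M, List.map_cons, List.map_nil, poly2_cons, poly2_nil,
        Nat.cast_one, Nat.cast_zero, Nat.reduceSub, pow_zero, pow_one, mul_one, mul_zero,
        zero_mul, add_zero] <;>
      field_simp <;> simp only [sigma, sinSq] at hS hP ⊢ <;> ring
  · -- (k,i) = (3,3)
    simp only [Fin.reduceFinMk, Fin.reduceFinMk, Fin.isValue, covOmega, covOmegaR, covOmegaM, Matrix.of_apply, Matrix.cons_val', Matrix.cons_val_one, Matrix.cons_val, Matrix.empty_val', Matrix.cons_val_fin_one]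
    refine (hasGrad_poly2_div _ _ _ _ hS hP hr').congr ?_ ?_ <;>
      simp only [cN33, dNR33, dNMu33, poly2R, poly2M, List.map_cons, List.map_nil, poly2_cons, poly2_nil,
        Nat.cast_ofNat, Nat.cast_one, Nat.cast_zero, Nat.reduceSub, pow_zero, pow_one, mul_one, mul_zero,
        zero_mul, add_zero, zero_add] <;>
      field_simp <;> simp only [sigma, sinSq] at hS hP ⊢ <;> ring

/-! ### `∇∇ω₍₀₎` and the rough d'Alembertian -/

/-- Near a point of `{Σ ≠ 0, μ² ≠ 1, r ≠ r₋}` the component functions of `∇ω₍₀₎` ARE the closed forms.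
[folklore] -/
theorem tcov_omega0_eventuallyEq (hu : u ∈ regularSet a) (hr : u 1 ≠ rm) (k i : Fin 4) :
    (fun y ↦ tcov (bilin M a) bF (omega0 a rm) y (ocons k (uidx i))) =ᶠ[𝓝 u]
      fun y ↦ covOmega M a rm y k i := by
  filter_upwards [(isOpen_regularSet_inter a rm).mem_nhds ⟨hu, hr⟩] with y hy
  exact tcov_omega0 hy.1 hy.2 k i

/-- **The second covariant derivative of `ω₍₀₎`** in terms of the closed forms:
`(∇∇ω₍₀₎)_{jki} = ∂_j(∇ω)_{ki} − Γ^m_{jk}(∇ω)_{mi} − Γ^m_{ji}(∇ω)_{km}`.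
[cite: ONeill1983, Ch. 2, Prop. 2.13] -/
theorem tcov_tcov_omega0 (hu : u ∈ regularSet a) (hr : u 1 ≠ rm) (j k i : Fin 4) :
    tcov (bilin M a) bF (tcov (bilin M a) bF (omega0 a rm)) u (ocons j (ocons k (uidx i))) =
      (covOmegaR M a rm u k i * (E4.basisVector j) 1 + covOmegaM M a rm u k i * (E4.basisVector j) 2)
        - (∑ m, chrCoef (bilin M a) bF u j k m * covOmega M a rm u m i
          + ∑ m, chrCoef (bilin M a) bF u j i m * covOmega M a rm u k m) := by
  rw [tcov_apply_ocons, Fintype.sum_option, (tcov_omega0_eventuallyEq hu hr k i).fderiv_eq, bF_apply,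
    (hasGrad_covOmega hu hr k i).fderiv_apply]
  simp only [Finset.univ_unique, PUnit.default_eq_unit, Finset.sum_singleton, ocons_none, ocons_some,
    update_ocons_none, update_ocons_some, update_uidx, tcov_omega0 hu hr]

set_option maxHeartbeats 8000000 in
/-- `(□ω₍₀₎)_0 = g^{jk}(∇∇ω₍₀₎)_{jk0} = 0` on Kerr, for all `M, a` and `r₋` with `Δ(r₋) = 0`.
[cite: Hintz2026, Lemma 6.10] -/
theorem tlap_omega0_0 (hu : u ∈ regularSet a) (hr : u 1 ≠ rm) (hrel : rm ^ 2 - 2 * M * rm + a ^ 2 = 0) :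
    tlap (bilin M a) bF (omega0 a rm) u (uidx 0) = 0 := by
  have hS := hu.1
  have hP := hu.2
  have hr' : u 1 - rm ≠ 0 := sub_ne_zero.mpr hr
  rw [tlap_apply]
  simp only [tcov_tcov_omega0 hu hr, Fin.sum_univ_four, ginv_basisFun M a hu, chrCoef_bF]
  simp only [Fin.isValue, bv_apply, Fin.reduceEq, if_true, if_false, mul_one, mul_zero, add_zero,
    zero_add]
  simp only [Fin.isValue, ginvMat, Matrix.of_apply, Matrix.cons_val', Matrix.cons_val_zero, Matrix.cons_val_one, Matrix.cons_val, Matrix.empty_val', Matrix.cons_val_fin_one, zero_mul, add_zero, zero_add]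
  simp only [Fin.isValue, chrAt_bv_00 M a hu, chrAt_bv_01 M a hu, chrAt_bv_02 M a hu, chrAt_bv_03 M a hu, chrAt_bv_11 M a hu, chrAt_bv_13 M a hu, chrAt_bv_22 M a hu, chrAt_bv_33 M a hu, chrAt_bv_swap M a hu 1 0, chrAt_bv_swap M a hu 2 0, chrAt_bv_swap M a hu 3 0, chrAt_bv_swap M a hu 3 1, PiLp.toLp_apply]
  simp only [Fin.isValue, covOmega, covOmegaR, covOmegaM, Matrix.of_apply, Matrix.cons_val', Matrix.cons_val_zero, Matrix.cons_val_one, Matrix.cons_val, Matrix.empty_val', Matrix.cons_val_fin_one, cN00, cN01, cN03, cN10, cN11, cN12, cN13, cN20, cN21, cN22, cN23, cN30, cN31, cN32, cN33, dNR00, dNMu00, dNR10, dNMu10, dNR20, dNMu20, dNR30, dNMu30,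
    poly2_cons, poly2_nil, pow_zero, pow_one, mul_one, h00, scalarH]
  rcases eq_or_ne rm 0 with h0 | h0
  · subst h0
    have ha : a = 0 := by nlinarith [hrel, sq_nonneg a]
    subst ha
    field_simp
    simp only [sigma, sinSq] at hS hP ⊢
    ring
  · have hM : M = (rm ^ 2 + a ^ 2) / (2 * rm) := by
      field_simp
      linarith [hrel]
    subst hM
    field_simp
    simp only [sigma, sinSq] at hS hP ⊢
    ring

set_option maxHeartbeats 8000000 in
/-- `(□ω₍₀₎)_1 = g^{jk}(∇∇ω₍₀₎)_{jk1} = 0` on Kerr, for all `M, a` and `r₋` with `Δ(r₋) = 0`.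
[cite: Hintz2026, Lemma 6.10] -/
theorem tlap_omega0_1 (hu : u ∈ regularSet a) (hr : u 1 ≠ rm) (hrel : rm ^ 2 - 2 * M * rm + a ^ 2 = 0) :
    tlap (bilin M a) bF (omega0 a rm) u (uidx 1) = 0 := by
  have hS := hu.1
  have hP := hu.2
  have hr' : u 1 - rm ≠ 0 := sub_ne_zero.mpr hr
  rw [tlap_apply]
  simp only [tcov_tcov_omega0 hu hr, Fin.sum_univ_four, ginv_basisFun M a hu, chrCoef_bF]
  simp only [Fin.isValue, bv_apply, Fin.reduceEq, if_true, if_false, mul_one, mul_zero, add_zero,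
    zero_add]
  simp only [Fin.isValue, ginvMat, Matrix.of_apply, Matrix.cons_val', Matrix.cons_val_zero, Matrix.cons_val_one, Matrix.cons_val, Matrix.empty_val', Matrix.cons_val_fin_one, zero_mul, add_zero, zero_add]
  simp only [Fin.isValue, chrAt_bv_00 M a hu, chrAt_bv_01 M a hu, chrAt_bv_11 M a hu, chrAt_bv_12 M a hu, chrAt_bv_13 M a hu, chrAt_bv_22 M a hu, chrAt_bv_33 M a hu, chrAt_bv_swap M a hu 1 0, chrAt_bv_swap M a hu 2 1, chrAt_bv_swap M a hu 3 1, PiLp.toLp_apply]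
  simp only [Fin.isValue, covOmega, covOmegaR, covOmegaM, Matrix.of_apply, Matrix.cons_val', Matrix.cons_val_zero, Matrix.cons_val_one, Matrix.cons_val, Matrix.empty_val', Matrix.cons_val_fin_one, cN00, cN01, cN03, cN10, cN11, cN12, cN13, cN20, cN21, cN22, cN23, cN30, cN31, cN32, cN33, dNR01, dNMu01, dNR11, dNMu11, dNR21, dNMu21, dNR31, dNMu31,
    poly2_cons, poly2_nil, pow_zero, pow_one, mul_one, h00, scalarH]
  rcases eq_or_ne rm 0 with h0 | h0
  · subst h0
    have ha : a = 0 := by nlinarith [hrel, sq_nonneg a]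
    subst ha
    field_simp
    simp only [sigma, sinSq] at hS hP ⊢
    ring
  · have hM : M = (rm ^ 2 + a ^ 2) / (2 * rm) := by
      field_simp
      linarith [hrel]
    subst hM
    field_simp
    simp only [sigma, sinSq] at hS hP ⊢
    ring

set_option maxHeartbeats 8000000 in
/-- `(□ω₍₀₎)_2 = g^{jk}(∇∇ω₍₀₎)_{jk2} = 0` on Kerr, for all `M, a` and `r₋` with `Δ(r₋) = 0`.
[cite: Hintz2026, Lemma 6.10] -/
theorem tlap_omega0_2 (hu : u ∈ regularSet a) (hr : u 1 ≠ rm) (hrel : rm ^ 2 - 2 * M * rm + a ^ 2 = 0) :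
    tlap (bilin M a) bF (omega0 a rm) u (uidx 2) = 0 := by
  have hS := hu.1
  have hP := hu.2
  have hr' : u 1 - rm ≠ 0 := sub_ne_zero.mpr hr
  rw [tlap_apply]
  simp only [tcov_tcov_omega0 hu hr, Fin.sum_univ_four, ginv_basisFun M a hu, chrCoef_bF]
  simp only [Fin.isValue, bv_apply, Fin.reduceEq, if_true, if_false, mul_one, mul_zero, add_zero,
    zero_add]
  simp only [Fin.isValue, ginvMat, Matrix.of_apply, Matrix.cons_val', Matrix.cons_val_zero, Matrix.cons_val_one, Matrix.cons_val, Matrix.empty_val', Matrix.cons_val_fin_one, zero_mul, add_zero, zero_add]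
  simp only [Fin.isValue, chrAt_bv_00 M a hu, chrAt_bv_01 M a hu, chrAt_bv_02 M a hu, chrAt_bv_11 M a hu, chrAt_bv_12 M a hu, chrAt_bv_13 M a hu, chrAt_bv_22 M a hu, chrAt_bv_23 M a hu, chrAt_bv_33 M a hu, chrAt_bv_swap M a hu 1 0, chrAt_bv_swap M a hu 3 1, chrAt_bv_swap M a hu 3 2, PiLp.toLp_apply]
  simp only [Fin.isValue, covOmega, covOmegaR, covOmegaM, Matrix.of_apply, Matrix.cons_val', Matrix.cons_val_zero, Matrix.cons_val_one, Matrix.cons_val, Matrix.empty_val', Matrix.cons_val_fin_one, cN00, cN01, cN03, cN10, cN11, cN12, cN13, cN20, cN21, cN22, cN23, cN30, cN31, cN32, cN33, dNR12, dNMu12, dNR22, dNMu22, dNR32, dNMu32,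
    poly2_cons, poly2_nil, pow_zero, pow_one, mul_one, h00, scalarH]
  rcases eq_or_ne rm 0 with h0 | h0
  · subst h0
    have ha : a = 0 := by nlinarith [hrel, sq_nonneg a]
    subst ha
    field_simp
    simp only [sigma, sinSq] at hS hP ⊢
    ring
  · have hM : M = (rm ^ 2 + a ^ 2) / (2 * rm) := by
      field_simp
      linarith [hrel]
    subst hM
    field_simp
    simp only [sigma, sinSq] at hS hP ⊢
    ring

set_option maxHeartbeats 8000000 in
/-- `(□ω₍₀₎)_3 = g^{jk}(∇∇ω₍₀₎)_{jk3} = 0` on Kerr, for all `M, a` and `r₋` with `Δ(r₋) = 0`.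
[cite: Hintz2026, Lemma 6.10] -/
theorem tlap_omega0_3 (hu : u ∈ regularSet a) (hr : u 1 ≠ rm) (hrel : rm ^ 2 - 2 * M * rm + a ^ 2 = 0) :
    tlap (bilin M a) bF (omega0 a rm) u (uidx 3) = 0 := by
  have hS := hu.1
  have hP := hu.2
  have hr' : u 1 - rm ≠ 0 := sub_ne_zero.mpr hr
  rw [tlap_apply]
  simp only [tcov_tcov_omega0 hu hr, Fin.sum_univ_four, ginv_basisFun M a hu, chrCoef_bF]
  simp only [Fin.isValue, bv_apply, Fin.reduceEq, if_true, if_false, mul_one, mul_zero, add_zero,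
    zero_add]
  simp only [Fin.isValue, ginvMat, Matrix.of_apply, Matrix.cons_val', Matrix.cons_val_zero, Matrix.cons_val_one, Matrix.cons_val, Matrix.empty_val', Matrix.cons_val_fin_one, zero_mul, add_zero, zero_add]
  simp only [Fin.isValue, chrAt_bv_00 M a hu, chrAt_bv_01 M a hu, chrAt_bv_03 M a hu, chrAt_bv_11 M a hu, chrAt_bv_13 M a hu, chrAt_bv_22 M a hu, chrAt_bv_23 M a hu, chrAt_bv_33 M a hu, chrAt_bv_swap M a hu 1 0, chrAt_bv_swap M a hu 3 1, PiLp.toLp_apply]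
  simp only [Fin.isValue, covOmega, covOmegaR, covOmegaM, Matrix.of_apply, Matrix.cons_val', Matrix.cons_val_zero, Matrix.cons_val_one, Matrix.cons_val, Matrix.empty_val', Matrix.cons_val_fin_one, cN00, cN01, cN03, cN10, cN11, cN12, cN13, cN20, cN21, cN22, cN23, cN30, cN31, cN32, cN33, dNR03, dNMu03, dNR13, dNMu13, dNR23, dNMu23, dNR33, dNMu33,
    poly2_cons, poly2_nil, pow_zero, pow_one, mul_one, h00, scalarH]
  rcases eq_or_ne rm 0 with h0 | h0
  · subst h0
    have ha : a = 0 := by nlinarith [hrel, sq_nonneg a]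
    subst ha
    field_simp
    simp only [sigma, sinSq] at hS hP ⊢
    ring
  · have hM : M = (rm ^ 2 + a ^ 2) / (2 * rm) := by
      field_simp
      linarith [hrel]
    subst hM
    field_simp
    simp only [sigma, sinSq] at hS hP ⊢
    ring

/-- **`ω₍₀₎` is a zero-energy state of the 1-form wave operator on Kerr, for every spin**: the rough
(tensor) d'Alembertian `(□ω₍₀₎)_i = g^{jk}(∇∇ω₍₀₎)_{jki}` (`MetricCoord.tlap`, O'Neill's `tr ∇²`) of
Hintz's/AHW's stationary 1-form `ω₍₀₎` vanishes identically, at every point of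
`{Σ ≠ 0, μ² ≠ 1, r ≠ r₋}` (which contains the future event horizon `r = r₊` when `r₋ < r₊`), for all
`M, a ∈ ℝ` and every root `r₋` of `Δ = r² − 2Mr + a²`. Hintz arXiv:2606.28253v2, Lemma 6.10 (whose
printed proof is the citation of AHW arXiv:2207.12952, Thm 5.1(2)); the kernel statement here is the
explicit verification, the dimension count ("spanned by") is NOT asserted. [cite: Hintz2026, Lemma 6.10] -/
theorem tlap_omega0 (hu : u ∈ regularSet a) (hr : u 1 ≠ rm) (hrel : rm ^ 2 - 2 * M * rm + a ^ 2 = 0)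
    (I : Unit → Fin 4) : tlap (bilin M a) bF (omega0 a rm) u I = 0 := by
  rw [← uidx_eta I]
  generalize I () = i
  fin_cases i
  · exact tlap_omega0_0 hu hr hrel
  · exact tlap_omega0_1 hu hr hrel
  · exact tlap_omega0_2 hu hr hrel
  · exact tlap_omega0_3 hu hr hrel

/-- **Hintz's gauge potential wave operator annihilates `ω₍₀₎`.** With `A = 2δ_g^*ω` the deformation
tensor (`MetricCoord.deform`), Hintz's `□_{g} ω := 2 δ_g 𝖦_g δ_g^* ω` (arXiv:2606.28253v2, eq. (4.6)
`Eq1BoxUps`, with `E^Υ = 0`; `δ_g h = −∇^a h_{a·}`, `𝖦_g h = h − ½ g tr_g h`) has components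
`−(Σ_{pq} g^{pq}(∇_p A)_{qi} − ½ Σ_{pq} g^{pq}(∇_i A)_{pq})`, which by the tree's contracted Ricci
identity `MetricCoord.IsMetricOn.trace_tcov_deform_sub_half` equals `−((□ω)_i + (Ric·ω)_i)`; so it
vanishes on `ω₍₀₎` at every point of an open set of `{Σ ≠ 0, μ² ≠ 1, r ≠ r₋}` on which the Kerr components
are Ricci-flat in the coordinate sense (`hRic`; the tree proves `Ric = 0` for these components at the
manifold level, `Kerr.Ingoing.ricci_eq_zero_of_repr` / `Kerr.isRicciFlat_holds`).
[cite: Hintz2026, Lemma 6.10] -/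
theorem gaugeWaveOp_omega0 {V : Set E4} (hV : IsOpen V) (hVsub : V ⊆ regularSet a ∩ {u | u 1 ≠ rm})
    (hRic : ∀ y ∈ V, ricAt (bilin M a) y = 0) (hrel : rm ^ 2 - 2 * M * rm + a ^ 2 = 0) (hu : u ∈ V)
    (i : Fin 4) :
    ∑ p, ∑ q, ginv (bilin M a) bF u p q *
        tcov (bilin M a) bF (deform (bilin M a) bF (omega0 a rm)) u (ocons p (ocons q (uidx i)))
      - (1 / 2) * ∑ p, ∑ q, ginv (bilin M a) bF u p q *
        tcov (bilin M a) bF (deform (bilin M a) bF (omega0 a rm)) u (ocons i (ocons p (uidx q))) = 0 := by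
  have hG : IsMetricOn (bilin M a) V :=
    ⟨hV, (contDiffOn_bilin M a).mono fun y hy ↦ (hVsub hy).1, fun y hy v w ↦ bilin_symm M a y v w,
      fun y hy ↦ isInvertible_bilin M a (hVsub hy).1⟩
  have hT : TSmoothOn (omega0 a rm) V := (tsmoothOn_omega0 a rm).mono hVsub
  rw [hG.trace_tcov_deform_sub_half hT hu i, tlap_omega0 (hVsub hu).1 (hVsub hu).2 hrel, hRic u hu]
  simp

/-- **Hintz's gauge potential wave operator annihilates `ω₍₀₎`, unconditionally**: at every point of
`{Σ ≠ 0, μ² ≠ 1, r ≠ r₋}` and for all `M, a` and every root `r₋` of `Δ`, the components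
`Σ_{pq} g^{pq}(∇_p A)_{qi} − ½ Σ_{pq} g^{pq}(∇_i A)_{pq}` (`A = 2δ_g^*ω₍₀₎`; `= −(2δ_g𝖦_gδ_g^*ω₍₀₎)_i`,
Hintz arXiv:2606.28253v2 eq. (4.6) with `E^Υ = 0`) vanish — `gaugeWaveOp_omega0` with the coordinate
Ricci-flatness of the Kerr components supplied by `Kerr.Ingoing.ricAt_bilin_eq_zero`. This is the explicit
("`ω₍₀₎ ∈ ker \widehat{□_{g_b}}(0)`") half of Lemma 6.10 for the whole Kerr family; "spanned by" is not
asserted. [cite: Hintz2026, Lemma 6.10] -/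
theorem gaugeWaveOp_omega0' (hu : u ∈ regularSet a) (hr : u 1 ≠ rm)
    (hrel : rm ^ 2 - 2 * M * rm + a ^ 2 = 0) (i : Fin 4) :
    ∑ p, ∑ q, ginv (bilin M a) bF u p q *
        tcov (bilin M a) bF (deform (bilin M a) bF (omega0 a rm)) u (ocons p (ocons q (uidx i)))
      - (1 / 2) * ∑ p, ∑ q, ginv (bilin M a) bF u p q *
        tcov (bilin M a) bF (deform (bilin M a) bF (omega0 a rm)) u (ocons i (ocons p (uidx q))) = 0 :=
  gaugeWaveOp_omega0 (isOpen_regularSet_inter a rm) subset_rfl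
    (fun _ hy ↦ ricAt_bilin_eq_zero M a hy.1) hrel ⟨hu, hr⟩ i

/-! ### Lemma 6.11, eq. (6.23) `EqWG0Pair2`: the profile of `ι_{∂_{t₀}} ι_{∇r} δ_g^* ω₍₀₎` — the "explicit computation" -/

/-- **Hintz 2026, Lemma 6.11 (`LemmaWG0Pair`), eq. (6.23) `EqWG0Pair2` — the "explicit computation", doubled.**
The printed proof (arXiv:2606.28253v2, TeX l. 6193) reads: "we can choose `c^Υ_{𝓗⁺}` as required provided
`η = δ(r − r_{b₀}⁺) ι_{∇r} δ^*_{g_{b₀}} ω₍₀₎ ≠ 0`; this in turn follows from an explicit computation" (the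
argument is that of P. Hintz, *Gluing small black holes along timelike geodesics III*, arXiv:2408.06715,
Prop. 3.12). Here is that computation in closed form, for ALL `M, a, r₋ ∈ ℝ` (no relation among them is
needed for this identity): with `A = deform = ∇ω₍₀₎ + (∇ω₍₀₎)ᵀ = 2 δ_g^* ω₍₀₎` (Hintz, TeX l. 1649:
`(δ_g^*ω)_{μν} := ½(ω_{μ;ν} + ω_{ν;μ})`, l. 3956: `= ½𝓛_{ω♯}g`; Wald (C.2.16)) and `∇r = Σ_k g^{rk} ∂_k` (`g^{rk}` = row `1` of `ginvMat`), the `∂_{t*}`-component of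
`ι_{∇r} A` — and `∂_{t*}` at fixed `(r, μ, φ)` IS Hintz's `∂_{t₀}`, since `t₀ = t* + r` — equals
`−(r² + a²)(r² − a²μ²)/Σ³` at every point with `Σ ≠ 0`, `μ² ≠ 1`, `r ≠ r₋`. [cite: Hintz2026, Lemma 6.11] -/
theorem gradr_deform_omega0_tstar (hu : u ∈ regularSet a) (hr : u 1 ≠ rm) :
    ∑ k, ginv (bilin M a) bF u 1 k * deform (bilin M a) bF (omega0 a rm) u (ocons k (uidx 0)) =
      -((u 1 ^ 2 + a ^ 2) * (u 1 ^ 2 - a ^ 2 * u 2 ^ 2)) / sigma a u ^ 3 := by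
  have hS := hu.1
  have hP := hu.2
  have hr' : u 1 - rm ≠ 0 := sub_ne_zero.mpr hr
  simp only [Fin.sum_univ_four, deform_apply, ginv_basisFun M a hu, tcov_omega0 hu hr]
  simp only [Fin.isValue, ginvMat, covOmega, Matrix.of_apply, Matrix.cons_val', Matrix.cons_val_zero,
    Matrix.cons_val_one, Matrix.cons_val, Matrix.empty_val', Matrix.cons_val_fin_one, cN00, cN01, cN03,
    cN10, cN11, cN12, cN13, cN20, cN21, cN22, cN23, cN30, cN31, cN32, cN33, poly2_cons, poly2_nil,
    pow_zero, pow_one, mul_one, zero_mul, add_zero, h00, scalarH]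
  field_simp
  simp only [sigma, sinSq] at hS hP ⊢
  ring

/-- **The profile of `η`**: `ι_{∂_{t₀}} ι_{∇r} δ_g^* ω₍₀₎ = −(r² + a²)(r² − a²μ²) / (2Σ³)` (`μ = cos θ`,
`Σ = ϱ² = r² + a²cos²θ`), for all `M, a, r₋` at every point with `Σ ≠ 0`, `μ² ≠ 1`, `r ≠ r₋` — the closed form
of the "explicit computation" of Hintz arXiv:2606.28253v2, Lemma 6.11, proof of (6.23) (= arXiv:2408.06715,
Prop. 3.12, proof, where the value is printed as `−(r̂² − a²cos²θ)/(4ϱ⁶)`, an expression with the same zero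
set). Independent of `M` and `r₋`. [cite: Hintz2026, Lemma 6.11] -/
theorem gradr_deltaStar_omega0_tstar (hu : u ∈ regularSet a) (hr : u 1 ≠ rm) :
    ∑ k, ginv (bilin M a) bF u 1 k *
        ((1 / 2 : ℝ) * deform (bilin M a) bF (omega0 a rm) u (ocons k (uidx 0))) =
      -((u 1 ^ 2 + a ^ 2) * (u 1 ^ 2 - a ^ 2 * u 2 ^ 2)) / (2 * sigma a u ^ 3) := by
  have hS := hu.1
  simp_rw [mul_left_comm _ (1 / 2 : ℝ), ← Finset.mul_sum, gradr_deform_omega0_tstar hu hr]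
  field_simp

/-- **`η ≠ 0` wherever `a²μ² ≤ a² < r²`**: the profile `ι_{∂_{t₀}} ι_{∇r} δ_g^* ω₍₀₎` is NEGATIVE at every
point with `μ² ≤ 1` (`μ = cos θ`) and `a² < r²` (and `Σ ≠ 0`, `μ² ≠ 1`, `r ≠ r₋`). [cite: Hintz2026, Lemma 6.11] -/
theorem gradr_deltaStar_omega0_tstar_neg (hu : u ∈ regularSet a) (hr : u 1 ≠ rm) (hμ : u 2 ^ 2 ≤ 1)
    (ha : a ^ 2 < u 1 ^ 2) :
    ∑ k, ginv (bilin M a) bF u 1 k *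
        ((1 / 2 : ℝ) * deform (bilin M a) bF (omega0 a rm) u (ocons k (uidx 0))) < 0 := by
  rw [gradr_deltaStar_omega0_tstar hu hr, neg_div]
  have ha2 : 0 ≤ a ^ 2 := sq_nonneg a
  have h1 : 0 < u 1 ^ 2 + a ^ 2 := by linarith
  have h2 : 0 < u 1 ^ 2 - a ^ 2 * u 2 ^ 2 := by nlinarith [mul_le_mul_of_nonneg_left hμ ha2]
  have h3 : 0 < sigma a u := by
    unfold sigma
    nlinarith [mul_nonneg ha2 (sq_nonneg (u 2))]
  exact neg_lt_zero.mpr (div_pos (mul_pos h1 h2) (mul_pos two_pos (pow_pos h3 3)))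

/-- On the future event horizon `r = r₊ = M + √(M² − a²)` of a SUBEXTREMAL Kerr black hole (`|a| < M`)
the hypothesis `a² < r²` of `gradr_deltaStar_omega0_tstar_neg` holds: `a² < M² ≤ r₊²`. [folklore] -/
theorem sq_lt_rPlus_sq_of_abs_lt (hM : |a| < M) : a ^ 2 < rPlus M a ^ 2 := by
  have hM0 : 0 < M := lt_of_le_of_lt (abs_nonneg a) hM
  have h := abs_lt.mp hM
  have h2 : a ^ 2 < M ^ 2 := sq_lt_sq' h.1 h.2
  have h1 : M ≤ rPlus M a := by
    unfold rPlus
    linarith [Real.sqrt_nonneg (M ^ 2 - a ^ 2)]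
  have h3 : M ^ 2 ≤ rPlus M a ^ 2 := by
    rw [sq, sq]
    exact mul_self_le_mul_self hM0.le h1
  exact lt_of_lt_of_le h2 h3

/-- **Lemma 6.11's horizon gauge 1-form exists for EVERY subextremal Kerr black hole.** On
`𝓗⁺ = {r = r₊}`, `|a| < M`, the profile `ι_{∂_{t₀}} ι_{∇r} δ_g^* ω₍₀₎ = −(r₊² + a²)(r₊² − a²cos²θ)/(2Σ³)` is
negative at every point of the chart (`μ² < 1`; by continuity of the closed form also at the poles, where
`r₊² − a² > 0`), so `η = δ(r − r₊) ι_{∇r} δ_g^* ω₍₀₎ ≠ 0` and a compactly supported `c^Υ_{𝓗⁺}` with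
`⟨η, c^Υ_{𝓗⁺}⟩ = 4π` exists (Hintz arXiv:2606.28253v2, Lemma 6.11, proof, l. 6193) — for all `|a| < M`, with no
smallness of `|a|/M`; the profile degenerates exactly in the extremal limit `r₊ = M = |a|` at the poles. The
parameter `r₋` of `ω₍₀₎` is arbitrary here (`≠ r₊`); in Lemma 6.10 it is the inner root of `Δ`. Only this
pointwise statement is certified; the function spaces and the pairing normalisation of Lemma 6.11 are not.
[cite: Hintz2026, Lemma 6.11] -/
theorem gradr_deltaStar_omega0_tstar_neg_horizon (hM : |a| < M) (hu : u ∈ regularSet a)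
    (hhor : u 1 = rPlus M a) (hr : u 1 ≠ rm) (hμ : u 2 ^ 2 ≤ 1) :
    ∑ k, ginv (bilin M a) bF u 1 k *
        ((1 / 2 : ℝ) * deform (bilin M a) bF (omega0 a rm) u (ocons k (uidx 0))) < 0 :=
  gradr_deltaStar_omega0_tstar_neg hu hr hμ (by rw [hhor]; exact sq_lt_rPlus_sq_of_abs_lt hM)

end Ingoing

end Kerr

end Literature.Geometry.Lorentzian

end
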